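import Mathlib.Algebra.BigOperators.Fin
import Literature.Computability.AlgebraicComplexity.QuantumFunctionalsUpperEqLower
import Literature.Computability.AlgebraicComplexity.QuantumFunctionalsDirectSumUpper
import Literature.NumberTheory.DiophantineGeometry.WordIsotypicSupport
import HarnessLib

/-!
# Sub-additivity of the quantum functionals under direct sum (CVZ Lemma 3.11) and the discharge of
# `ChristandlVranaZuiddam2023_directSum` (Cor. 3.31, additivity)

Topic `Literature/Computability/AlgebraicComplexity`; proofs file (theorems only) for
M. Christandl, P. Vrana, J. Zuiddam, *Universal points in the asymptotic spectrum of tensors*,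
J. Amer. Math. Soc. 36 (2023) 31–79 = arXiv:1709.07851v3, **Lemma 3.11** (= Thm. 3.5.2):
`F^θ(s ⊕ t) ≤ F^θ(s) + F^θ(t)` for the upper quantum functional of Def. 3.3 and `θ ∈ P_nc(B)` (for
`k = 3` all of `P([3])`), i.e. the named fact `ChristandlVranaZuiddam2023_upper_subadditive`
(`QuantumFunctionalsUpper.lean`); together with Thm. 3.30 (`ChristandlVranaZuiddam2023_upper_eq_lower_holds`,
`QuantumFunctionalsUpperEqLower.lean`) and the proved super-additivity (Thm. 3.19.2,
`QuantumFunctionalsDirectSum.lean`) this discharges `ChristandlVranaZuiddam2023_directSum_subadditive` and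
the additivity fact `ChristandlVranaZuiddam2023_directSum` of `QuantumFunctionals.lean` (Cor. 3.31):
`F_θ(s ⊕ t) = F_θ(s) + F_θ(t)`.

## The printed proof and the proof given here

CVZ (p. 13): an admissible tuple `(λ⁽ʲ⁾ ⊢ n)` for `(s ⊕ t)^{⊗n} = ∑_m (s^{⊗m} ⊗ t^{⊗(n-m)})`-terms forces,
for some `m`, admissible tuples `(μ⁽ʲ⁾ ⊢ m)` for `s` and `(ν⁽ʲ⁾ ⊢ n-m)` for `t` with
`P_λ (P_μ ⊗ P_ν) ≠ 0`, hence nonzero Littlewood–Richardson coefficients `c^λ_{μν}` and (Lemma 3.10.2,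
via the semigroup property and dimension bounds) `H(λ̄) ≤ p H(μ̄) + (1-p) H(ν̄) + h(p)`, `p = m/n`;
the entropy trick Lemma 3.12 concludes. The proof below follows this architecture with two
elementary substitutions, both standard:

* the binomial expansion is taken over subsets `S ⊆ [n]` of positions (`kroneckerPow_add_eq_sum`),
  each term being a *concatenation product* of `s^{⊗m}` and `t^{⊗k}` along a splitting
  `[m] ⊔ [k] ≃ [n]` (`exists_splitting`, `binomialTerm_eq_conc`), everything living on the
  concatenated alphabets `Fin (a + a')` into which `s` and `t` are embedded by the letter inclusions
  `Φ_V`, `Φ_W` (§2; `E·(s ⊕ t) = Φ_V·s + Φ_W·t`, `actTensor_relabel_directSumTensor`);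
* Lemma 3.10.2 is replaced by its dominance form: the leg-`j` columns of the embedded projected powers
  lie in the span of `B^{⊗m} ξ̂`, `B = Φ_V g Φ_Vᵀ + Φ_W h Φ_Wᵀ` block-diagonal and `ξ̂` an embedded
  highest-weight vector of weight `μ` (span form of Schur–Weyl duality, `range_isotypicProj_wordPermRep`);
  `P_λ` commutes with `B^{⊗n}`, so it meets a word of content `(μ on V-letters, ν on W-letters)`, which
  is therefore dominated by `λ` (majorisation property, CVZ Rem. 3.33,
  `card_filter_mem_le_of_mem_range_charSum` of `WordIsotypicSupport.lean`), and Schur-concavity of the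
  Shannon entropy (`partitionEntropy_le_of_dominated`, `EntropyMajorisation.lean`) gives exactly
  `H(λ̄) ≤ h(m/n) + (m/n) H(μ̄) + (k/n) H(ν̄)` (`partitionEntropy_le_of_mulVec_conc_ne_zero`, the heart, §6).
  (The dominance `λ ⊵ μ ∪ ν` is the classical necessary condition for `c^λ_{μν} ≠ 0`.)

Lemma 3.12 is proved in inequality form from Gibbs' inequality (`binEntropy_add_weights_le_logb`).
Legs with `θⱼ = 0` are completed to full triples by `∑_ν P_ν = 1` (`exists_full_triple`), and the
relabellings use `F^θ = F_θ` (Thm. 3.30) and the invariance of `E_θ`.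

Main results: `weightedEntropy_le_logb_of_full_triple`, `upperQuantumFunctional_directSumTensor_le`
(`F^θ(s ⊕ t) ≤ F^θ(s) + F^θ(t)` on arbitrary finite index types),
`ChristandlVranaZuiddam2023_upper_subadditive_holds`, `ChristandlVranaZuiddam2023_directSum_subadditive_holds`,
`ChristandlVranaZuiddam2023_directSum_holds`. No definitions, no named facts.

## References

* M. Christandl, P. Vrana, J. Zuiddam, J. Amer. Math. Soc. 36 (2023) 31–79 = arXiv:1709.07851v3,
  §3.1 ((sw), Def. 3.3, Thm. 3.5, Rem. 3.7, Def. 3.8, Rem. 3.9, Lemma 3.10, Lemma 3.11, Lemma 3.12),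
  Rem. 3.33, Thm. 3.30, Cor. 3.31. [ChristandlVranaZuiddam2023]
* W. Fulton, J. Harris, *Representation Theory*, GTM 129, Thm. 6.3, §15.5. [FultonHarrisGTM129]
* V. Strassen, J. reine angew. Math. 413 (1991) 127–180 (the entropy trick, as quoted in Lemma 3.12).
-/

noncomputable section

open scoped BigOperators Matrix ComplexOrder Kronecker

namespace Literature.Computability.AlgebraicComplexity

open Literature.NumberTheory.DiophantineGeometry (Word wordRep wordRep_apply wordPermRep
  tensorPowerMatrix spechtCharacter spechtCharacter_inv highestWeightSpace Weight
  apply_eq_zero_of_mem_highestWeightSpace)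
open Literature.RepresentationTheory.FiniteGroups (wordIsotypicMatrix wordIsotypicMatrix_mulVec
  wordIsotypicProj isotypicProj sum_wordIsotypicMatrix)
open Literature.RepresentationTheory.GeneralLinear (range_isotypicProj_wordPermRep)

/-! ## §1 Splittings of the positions, concatenation products, the binomial expansion -/

section Splitting

variable {N M L : ℕ} {m k n : ℕ}

/-- **Every set of positions is the left block of a splitting**: for `S ⊆ [n]` there are `m, k` and a
bijection `e : [m] ⊔ [k] ≃ [n]` mapping the left summand onto `S` and the right one onto its
complement. [folklore] -/
theorem exists_splitting (S : Finset (Fin n)) :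
    ∃ (m k : ℕ) (e : Fin m ⊕ Fin k ≃ Fin n), (∀ i, e (Sum.inl i) ∈ S) ∧ (∀ j, e (Sum.inr j) ∉ S) := by
  classical
  refine ⟨S.card, Sᶜ.card, (Equiv.sumCongr S.equivFin.symm
    ((Sᶜ.equivFin.symm).trans (Equiv.subtypeEquivRight (fun a => Finset.mem_compl)))).trans
      (Equiv.sumCompl (· ∈ S)), fun i => ?_, fun j => ?_⟩
  · simp only [Equiv.trans_apply, Equiv.sumCongr_apply, Sum.map_inl, Equiv.sumCompl_apply_inl]
    exact (S.equivFin.symm i).2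
  · simp only [Equiv.trans_apply, Equiv.sumCongr_apply, Sum.map_inr, Equiv.sumCompl_apply_inr]
    exact ((Sᶜ.equivFin.symm j)).2 |> fun h => Finset.mem_compl.1 h

/-- Products over a set of positions and its complement, along a splitting. [folklore] -/
theorem prod_mul_prod_compl_eq_of_splitting {R : Type*} [CommMonoid R] {S : Finset (Fin n)}
    {e : Fin m ⊕ Fin k ≃ Fin n} (hl : ∀ i, e (Sum.inl i) ∈ S) (hr : ∀ j, e (Sum.inr j) ∉ S)
    (f g : Fin n → R) :
    (∏ p ∈ S, f p) * ∏ p ∈ Sᶜ, g p = (∏ i, f (e (Sum.inl i))) * ∏ j, g (e (Sum.inr j)) := by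
  classical
  have key : ∏ p, (if p ∈ S then f p else g p) = (∏ p ∈ S, f p) * ∏ p ∈ Sᶜ, g p := by
    rw [← Finset.prod_filter_mul_prod_filter_not Finset.univ (· ∈ S)]
    congr 1
    · rw [Finset.filter_mem_eq_inter, Finset.univ_inter]
      exact Finset.prod_congr rfl fun p hp => if_pos hp
    · rw [show Finset.univ.filter (fun p => ¬ p ∈ S) = Sᶜ by ext p; simp]
      exact Finset.prod_congr rfl fun p hp => if_neg (Finset.mem_compl.1 hp)
  rw [← key, ← Fintype.prod_equiv e (fun x => if e x ∈ S then f (e x) else g (e x)) _ (fun _ => rfl),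
    Fintype.prod_sum_type]
  congr 1
  · exact Finset.prod_congr rfl fun i _ => if_pos (hl i)
  · exact Finset.prod_congr rfl fun j _ => if_neg (hr j)

/-- **Binomial expansion of a tensor power of a sum**: `(x + y)^{⊗n} = ∑_{S ⊆ [n]} x^{⊗S} y^{⊗Sᶜ}`,
where the `S`-term carries `x` on the positions in `S` and `y` on the others (simultaneously on the
three legs). [folklore] -/
theorem kroneckerPow_add_eq_sum {ι κ μ : Type*} (x y : ι → κ → μ → ℂ) (n : ℕ) :
    kroneckerPow (x + y) n = ∑ S : Finset (Fin n), fun a b c =>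
      (∏ p ∈ S, x (a p) (b p) (c p)) * ∏ p ∈ Sᶜ, y (a p) (b p) (c p) := by
  funext a b c
  simp only [kroneckerPow_apply, Pi.add_apply, Finset.sum_apply]
  rw [Finset.prod_add]
  rw [Finset.powerset_univ]
  exact Finset.sum_congr rfl fun S _ => by rw [Finset.compl_eq_univ_sdiff]

/-- The `S`-term of the binomial expansion is a **concatenation product** of tensor powers along a
splitting `e` adapted to `S`: `x^{⊗S} y^{⊗Sᶜ} (w) = x^{⊗m}(w ∘ e ∘ inl) · y^{⊗k}(w ∘ e ∘ inr)`.
[folklore] -/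
theorem binomialTerm_eq_conc {ι κ μ : Type*} (x y : ι → κ → μ → ℂ) {S : Finset (Fin n)}
    {e : Fin m ⊕ Fin k ≃ Fin n} (hl : ∀ i, e (Sum.inl i) ∈ S) (hr : ∀ j, e (Sum.inr j) ∉ S) :
    (fun (a : Fin n → ι) (b : Fin n → κ) (c : Fin n → μ) =>
      (∏ p ∈ S, x (a p) (b p) (c p)) * ∏ p ∈ Sᶜ, y (a p) (b p) (c p)) =
    fun a b c => kroneckerPow x m (a ∘ ⇑e ∘ Sum.inl) (b ∘ ⇑e ∘ Sum.inl) (c ∘ ⇑e ∘ Sum.inl) *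
      kroneckerPow y k (a ∘ ⇑e ∘ Sum.inr) (b ∘ ⇑e ∘ Sum.inr) (c ∘ ⇑e ∘ Sum.inr) := by
  funext a b c
  rw [prod_mul_prod_compl_eq_of_splitting hl hr]
  simp only [kroneckerPow_apply, Function.comp_apply]

/-- The concatenation product is additive in the left factor over finite sums. [folklore] -/
theorem conc_sum_left {ι κ μ : Type*} {α : Type*} (s : Finset α)
    (X : α → (Fin m → ι) → (Fin m → κ) → (Fin m → μ) → ℂ)
    (X' : (Fin k → ι) → (Fin k → κ) → (Fin k → μ) → ℂ) (e : Fin m ⊕ Fin k ≃ Fin n) :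
    (fun (a : Fin n → ι) (b : Fin n → κ) (c : Fin n → μ) =>
      (∑ i ∈ s, X i) (a ∘ ⇑e ∘ Sum.inl) (b ∘ ⇑e ∘ Sum.inl) (c ∘ ⇑e ∘ Sum.inl) *
        X' (a ∘ ⇑e ∘ Sum.inr) (b ∘ ⇑e ∘ Sum.inr) (c ∘ ⇑e ∘ Sum.inr)) =
    ∑ i ∈ s, fun a b c => X i (a ∘ ⇑e ∘ Sum.inl) (b ∘ ⇑e ∘ Sum.inl) (c ∘ ⇑e ∘ Sum.inl) *
        X' (a ∘ ⇑e ∘ Sum.inr) (b ∘ ⇑e ∘ Sum.inr) (c ∘ ⇑e ∘ Sum.inr) := by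
  funext a b c
  simp only [Finset.sum_apply, Finset.sum_mul]

/-- The concatenation product is additive in the right factor over finite sums. [folklore] -/
theorem conc_sum_right {ι κ μ : Type*} {α : Type*} (s : Finset α)
    (X : (Fin m → ι) → (Fin m → κ) → (Fin m → μ) → ℂ)
    (X' : α → (Fin k → ι) → (Fin k → κ) → (Fin k → μ) → ℂ) (e : Fin m ⊕ Fin k ≃ Fin n) :
    (fun (a : Fin n → ι) (b : Fin n → κ) (c : Fin n → μ) =>
      X (a ∘ ⇑e ∘ Sum.inl) (b ∘ ⇑e ∘ Sum.inl) (c ∘ ⇑e ∘ Sum.inl) *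
        (∑ i ∈ s, X' i) (a ∘ ⇑e ∘ Sum.inr) (b ∘ ⇑e ∘ Sum.inr) (c ∘ ⇑e ∘ Sum.inr)) =
    ∑ i ∈ s, fun a b c => X (a ∘ ⇑e ∘ Sum.inl) (b ∘ ⇑e ∘ Sum.inl) (c ∘ ⇑e ∘ Sum.inl) *
        X' i (a ∘ ⇑e ∘ Sum.inr) (b ∘ ⇑e ∘ Sum.inr) (c ∘ ⇑e ∘ Sum.inr) := by
  funext a b c
  simp only [Finset.sum_apply, Finset.mul_sum]

/-- Words of length `n` correspond to pairs of words along a splitting. [folklore] -/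
theorem sum_word_eq_sum_sum_of_splitting {R : Type*} [AddCommMonoid R] {α : Type*} [Fintype α]
    (e : Fin m ⊕ Fin k ≃ Fin n) (F : (Fin n → α) → R) :
    ∑ w : Fin n → α, F w = ∑ u : Fin m → α, ∑ u' : Fin k → α,
      F (fun p => Sum.elim u u' (e.symm p)) := by
  rw [← Fintype.sum_prod_type']
  let φ : (Fin m → α) × (Fin k → α) ≃ (Fin n → α) :=
    { toFun := fun q p => Sum.elim q.1 q.2 (e.symm p)
      invFun := fun w => (w ∘ ⇑e ∘ Sum.inl, w ∘ ⇑e ∘ Sum.inr)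
      left_inv := by
        rintro ⟨u, u'⟩
        simp only [Prod.mk.injEq]
        constructor <;> funext i <;> simp
      right_inv := by
        intro w
        funext p
        rcases h : e.symm p with i | j
        · simp only [h, Sum.elim_inl, Function.comp_apply]
          rw [← h, Equiv.apply_symm_apply]
        · simp only [h, Sum.elim_inr, Function.comp_apply]
          rw [← h, Equiv.apply_symm_apply] }
  exact (Fintype.sum_equiv φ (fun q => F (φ q)) F (fun _ => rfl)).symm

/-- **Kronecker powers respect concatenation** (single leg): for every square matrix `A`,
`A^{⊗n} (v ⋆ₑ v') = (A^{⊗m} v) ⋆ₑ (A^{⊗k} v')`, where `(v ⋆ₑ v')(w) = v(w ∘ e ∘ inl) v'(w ∘ e ∘ inr)`.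
[folklore] -/
theorem powMat_mulVec_conc₁ (A : Matrix (Fin N) (Fin N) ℂ) (e : Fin m ⊕ Fin k ≃ Fin n)
    (v : Word N m → ℂ) (v' : Word N k → ℂ) :
    powMat A n *ᵥ (fun w : Word N n => v (w ∘ ⇑e ∘ Sum.inl) * v' (w ∘ ⇑e ∘ Sum.inr)) =
      fun w : Word N n => (powMat A m *ᵥ v) (w ∘ ⇑e ∘ Sum.inl) * (powMat A k *ᵥ v') (w ∘ ⇑e ∘ Sum.inr) := by
  funext w
  simp only [Matrix.mulVec, dotProduct, powMat_apply]
  rw [sum_word_eq_sum_sum_of_splitting e, Finset.sum_mul_sum]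
  refine Finset.sum_congr rfl fun u _ => Finset.sum_congr rfl fun u' _ => ?_
  -- split the product over positions along `e`
  have hprod : ∏ p : Fin n, A (w p) (Sum.elim u u' (e.symm p)) =
      (∏ i, A (w (e (Sum.inl i))) (u i)) * ∏ j, A (w (e (Sum.inr j))) (u' j) := by
    rw [← Fintype.prod_equiv e (fun x => A (w (e x)) (Sum.elim u u' (e.symm (e x)))) _ (fun _ => rfl),
      Fintype.prod_sum_type]
    simp only [Equiv.symm_apply_apply, Sum.elim_inl, Sum.elim_inr]
  have hl : (fun p => Sum.elim u u' (e.symm p)) ∘ ⇑e ∘ Sum.inl = u := by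
    funext i; simp
  have hr : (fun p => Sum.elim u u' (e.symm p)) ∘ ⇑e ∘ Sum.inr = u' := by
    funext j; simp
  rw [hprod, hl, hr]
  simp only [Function.comp_apply]
  ring

end Splitting

/-! ## §2 Letter blocks: the inclusions `Φ_V`, `Φ_W` of the two alphabets and block matrices -/

section Blocks

variable {a a' : ℕ}

/-- The inclusion matrix of an injective relabelling of letters is an isometry: `Φᵀ Φ = 1`.
[folklore] -/
theorem transpose_submatrix_one_mul_self {N : ℕ} {φ : Fin a → Fin N} (hφ : Function.Injective φ) :
    ((1 : Matrix (Fin N) (Fin N) ℂ).submatrix id φ)ᵀ * (1 : Matrix (Fin N) (Fin N) ℂ).submatrix id φ = 1 := by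
  have hΦ : ∀ x i, ((1 : Matrix (Fin N) (Fin N) ℂ).submatrix id φ) x i = (1 : Matrix (Fin N) (Fin N) ℂ) x (φ i) :=
    fun _ _ => rfl
  ext i j
  simp only [Matrix.mul_apply, Matrix.transpose_apply, hΦ]
  rw [Finset.sum_eq_single (φ i)]
  · rw [Matrix.one_apply_eq, one_mul]
    by_cases h : i = j
    · subst h; rw [Matrix.one_apply_eq, Matrix.one_apply_eq]
    · rw [Matrix.one_apply_ne h, Matrix.one_apply_ne (fun e => h (hφ e))]
  · intro x _ hx
    rw [Matrix.one_apply_ne hx, zero_mul]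
  · intro h; exact absurd (Finset.mem_univ _) h

/-- The two letter blocks are orthogonal: `Φ_Wᵀ Φ_V = 0`. [folklore] -/
theorem transpose_inclW_mul_inclV :
    ((1 : Matrix (Fin (a + a')) (Fin (a + a')) ℂ).submatrix id (Fin.natAdd a))ᵀ *
      (1 : Matrix (Fin (a + a')) (Fin (a + a')) ℂ).submatrix id (Fin.castAdd a') = 0 := by
  have hV : ∀ x i, ((1 : Matrix (Fin (a + a')) (Fin (a + a')) ℂ).submatrix id (Fin.castAdd a')) x i =
      (1 : Matrix (Fin (a + a')) (Fin (a + a')) ℂ) x (Fin.castAdd a' i) := fun _ _ => rfl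
  have hW : ∀ x j, ((1 : Matrix (Fin (a + a')) (Fin (a + a')) ℂ).submatrix id (Fin.natAdd a)) x j =
      (1 : Matrix (Fin (a + a')) (Fin (a + a')) ℂ) x (Fin.natAdd a j) := fun _ _ => rfl
  ext j i
  simp only [Matrix.mul_apply, Matrix.transpose_apply, hV, hW, Matrix.zero_apply]
  refine Finset.sum_eq_zero fun x _ => ?_
  by_cases h1 : x = Fin.natAdd a j
  · subst h1
    have hne : Fin.natAdd a j ≠ Fin.castAdd a' i := by
      intro h
      have h' : a + (j : ℕ) = (i : ℕ) := congrArg Fin.val h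
      have := i.isLt
      omega
    rw [Matrix.one_apply_eq, one_mul, Matrix.one_apply_ne hne]
  · rw [Matrix.one_apply_ne h1, zero_mul]

/-- Symmetrically `Φ_Vᵀ Φ_W = 0`. [folklore] -/
theorem transpose_inclV_mul_inclW :
    ((1 : Matrix (Fin (a + a')) (Fin (a + a')) ℂ).submatrix id (Fin.castAdd a'))ᵀ *
      (1 : Matrix (Fin (a + a')) (Fin (a + a')) ℂ).submatrix id (Fin.natAdd a) = 0 := by
  have h := congrArg Matrix.transpose (transpose_inclW_mul_inclV (a := a) (a' := a'))
  rwa [Matrix.transpose_mul, Matrix.transpose_transpose, Matrix.transpose_zero] at h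

/-- **The block-diagonal matrix `g ⊕ h` acts on the `V`-block through `g`**:
`(Φ_V g Φ_Vᵀ + Φ_W h Φ_Wᵀ) Φ_V = Φ_V g`. [folklore] -/
theorem blockDiag_mul_inclV (g : Matrix (Fin a) (Fin a) ℂ) (h : Matrix (Fin a') (Fin a') ℂ) :
    ((1 : Matrix (Fin (a + a')) (Fin (a + a')) ℂ).submatrix id (Fin.castAdd a') * g *
        ((1 : Matrix (Fin (a + a')) (Fin (a + a')) ℂ).submatrix id (Fin.castAdd a'))ᵀ +
      (1 : Matrix (Fin (a + a')) (Fin (a + a')) ℂ).submatrix id (Fin.natAdd a) * h *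
        ((1 : Matrix (Fin (a + a')) (Fin (a + a')) ℂ).submatrix id (Fin.natAdd a))ᵀ) *
      (1 : Matrix (Fin (a + a')) (Fin (a + a')) ℂ).submatrix id (Fin.castAdd a') =
    (1 : Matrix (Fin (a + a')) (Fin (a + a')) ℂ).submatrix id (Fin.castAdd a') * g := by
  rw [Matrix.add_mul, Matrix.mul_assoc, Matrix.mul_assoc,
    transpose_submatrix_one_mul_self (Fin.castAdd_injective a a'), Matrix.mul_one, Matrix.mul_assoc,
    Matrix.mul_assoc, transpose_inclW_mul_inclV, Matrix.mul_zero, Matrix.mul_zero, add_zero]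

/-- `(g ⊕ h) Φ_W = Φ_W h`. [folklore] -/
theorem blockDiag_mul_inclW (g : Matrix (Fin a) (Fin a) ℂ) (h : Matrix (Fin a') (Fin a') ℂ) :
    ((1 : Matrix (Fin (a + a')) (Fin (a + a')) ℂ).submatrix id (Fin.castAdd a') * g *
        ((1 : Matrix (Fin (a + a')) (Fin (a + a')) ℂ).submatrix id (Fin.castAdd a'))ᵀ +
      (1 : Matrix (Fin (a + a')) (Fin (a + a')) ℂ).submatrix id (Fin.natAdd a) * h *
        ((1 : Matrix (Fin (a + a')) (Fin (a + a')) ℂ).submatrix id (Fin.natAdd a))ᵀ) *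
      (1 : Matrix (Fin (a + a')) (Fin (a + a')) ℂ).submatrix id (Fin.natAdd a) =
    (1 : Matrix (Fin (a + a')) (Fin (a + a')) ℂ).submatrix id (Fin.natAdd a) * h := by
  rw [Matrix.add_mul, Matrix.mul_assoc, Matrix.mul_assoc, transpose_inclV_mul_inclW, Matrix.mul_zero,
    Matrix.mul_zero, zero_add, Matrix.mul_assoc, Matrix.mul_assoc,
    transpose_submatrix_one_mul_self (Fin.natAdd_injective a' a), Matrix.mul_one]

end Blocks

/-! ## §3 Isotypic projectors and letter inclusions; supports of embedded vectors -/

section Inclusion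

variable {a N : ℕ} {m : ℕ}

/-- **Permutation matrices commute with Kronecker powers of rectangular matrices**:
`Π_N(σ) Φ^{⊗m} = Φ^{⊗m} Π_a(σ)`. [folklore] -/
theorem wordPermMatrix_mul_powMat (σ : Equiv.Perm (Fin m)) (Φ : Matrix (Fin N) (Fin a) ℂ) :
    Literature.RepresentationTheory.FiniteGroups.wordPermMatrix N σ * powMat Φ m =
      powMat Φ m * Literature.RepresentationTheory.FiniteGroups.wordPermMatrix a σ := by
  ext w' u
  simp only [Matrix.mul_apply, Literature.RepresentationTheory.FiniteGroups.wordPermMatrix_apply,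
    powMat_apply, ite_mul, one_mul, zero_mul, mul_ite, mul_one, mul_zero]
  rw [Finset.sum_ite_eq' Finset.univ (w' ∘ ⇑σ), if_pos (Finset.mem_univ _)]
  have hiff : ∀ v : Word a m, u = v ∘ ⇑σ ↔ v = u ∘ ⇑σ⁻¹ := by
    intro v
    constructor
    · rintro rfl; funext p; simp
    · rintro rfl; funext p; simp
  simp only [hiff]
  rw [Finset.sum_ite_eq' Finset.univ (u ∘ ⇑σ⁻¹), if_pos (Finset.mem_univ _)]
  exact Fintype.prod_equiv σ (fun p => Φ ((w' ∘ ⇑σ) p) (u p)) (fun p => Φ (w' p) ((u ∘ ⇑σ⁻¹) p))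
    fun p => by simp

/-- **The isotypic projectors of the two alphabets are intertwined by the Kronecker power of any
letter matrix**: `P_λ^{(N)} Φ^{⊗m} = Φ^{⊗m} P_λ^{(a)}`. [cite: ChristandlVranaZuiddam2023, Lemma 3.6] -/
theorem wordIsotypicMatrix_mul_powMat (lam : Nat.Partition m) (Φ : Matrix (Fin N) (Fin a) ℂ) :
    wordIsotypicMatrix N m lam * powMat Φ m = powMat Φ m * wordIsotypicMatrix a m lam := by
  rw [Literature.RepresentationTheory.FiniteGroups.wordIsotypicMatrix_eq_sum,
    Literature.RepresentationTheory.FiniteGroups.wordIsotypicMatrix_eq_sum, Matrix.sum_mul,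
    Matrix.mul_sum]
  refine Finset.sum_congr rfl fun t _ => ?_
  rw [Matrix.smul_mul, Matrix.mul_smul, wordPermMatrix_mul_powMat]

/-- **Embedded vectors are supported on embedded words**: `(Φ^{⊗m} v)(w) ≠ 0` forces
`w = φ ∘ u` with `v(u) ≠ 0`, for the inclusion matrix `Φ` of an injective letter map `φ`. [folklore] -/
theorem exists_eq_comp_of_powMat_submatrix_mulVec_ne_zero {φ : Fin a → Fin N}
    (v : Word a m → ℂ) {w : Word N m}
    (hw : (powMat ((1 : Matrix (Fin N) (Fin N) ℂ).submatrix id φ) m *ᵥ v) w ≠ 0) :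
    ∃ u : Word a m, w = φ ∘ u ∧ v u ≠ 0 := by
  simp only [Matrix.mulVec, dotProduct, powMat_apply, Matrix.submatrix_apply] at hw
  obtain ⟨u, -, hu⟩ := Finset.exists_ne_zero_of_sum_ne_zero hw
  refine ⟨u, ?_, right_ne_zero_of_mul hu⟩
  have hprod := left_ne_zero_of_mul hu
  rw [Finset.prod_ne_zero_iff] at hprod
  funext p
  have h := hprod p (Finset.mem_univ _)
  by_contra hne
  exact h (Matrix.one_apply_ne hne)

end Inclusion

/-! ## §4 Spans, columns and the range of `P_λ` inside the range of the character sum -/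

section SpanTools

variable {N : ℕ} {m k n : ℕ}

/-- **Concatenation products of vectors from two spans lie in the span of the concatenation
products of generators** (bilinearity). [folklore] -/
theorem conc₁_mem_span {G₁ : Set (Word N m → ℂ)} {G₂ : Set (Word N k → ℂ)} (e : Fin m ⊕ Fin k ≃ Fin n)
    {f : Word N m → ℂ} {g : Word N k → ℂ} (hf : f ∈ Submodule.span ℂ G₁) (hg : g ∈ Submodule.span ℂ G₂) :
    (fun w : Word N n => f (w ∘ ⇑e ∘ Sum.inl) * g (w ∘ ⇑e ∘ Sum.inr)) ∈ Submodule.span ℂ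
      {v : Word N n → ℂ | ∃ x ∈ G₁, ∃ y ∈ G₂,
        v = fun w => x (w ∘ ⇑e ∘ Sum.inl) * y (w ∘ ⇑e ∘ Sum.inr)} := by
  set S := Submodule.span ℂ {v : Word N n → ℂ | ∃ x ∈ G₁, ∃ y ∈ G₂,
    v = fun w => x (w ∘ ⇑e ∘ Sum.inl) * y (w ∘ ⇑e ∘ Sum.inr)} with hS
  have h2 : ∀ x ∈ G₁, ∀ {g : Word N k → ℂ}, g ∈ Submodule.span ℂ G₂ →
      (fun w : Word N n => x (w ∘ ⇑e ∘ Sum.inl) * g (w ∘ ⇑e ∘ Sum.inr)) ∈ S := by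
    intro x hx g hg
    induction hg using Submodule.span_induction with
    | mem y hy => exact Submodule.subset_span ⟨x, hx, y, hy, rfl⟩
    | zero =>
      have : (fun w : Word N n => x (w ∘ ⇑e ∘ Sum.inl) * (0 : Word N k → ℂ) (w ∘ ⇑e ∘ Sum.inr)) = 0 := by
        funext w; simp
      rw [this]; exact Submodule.zero_mem _
    | add g g' _ _ h h' =>
      have : (fun w : Word N n => x (w ∘ ⇑e ∘ Sum.inl) * (g + g') (w ∘ ⇑e ∘ Sum.inr)) =
          (fun w => x (w ∘ ⇑e ∘ Sum.inl) * g (w ∘ ⇑e ∘ Sum.inr)) +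
            fun w => x (w ∘ ⇑e ∘ Sum.inl) * g' (w ∘ ⇑e ∘ Sum.inr) := by
        funext w; simp only [Pi.add_apply]; ring
      rw [this]; exact Submodule.add_mem _ h h'
    | smul r g _ h =>
      have : (fun w : Word N n => x (w ∘ ⇑e ∘ Sum.inl) * (r • g) (w ∘ ⇑e ∘ Sum.inr)) =
          r • fun w => x (w ∘ ⇑e ∘ Sum.inl) * g (w ∘ ⇑e ∘ Sum.inr) := by
        funext w; simp only [Pi.smul_apply, smul_eq_mul]; ring
      rw [this]; exact Submodule.smul_mem _ r h
  induction hf using Submodule.span_induction with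
  | mem x hx => exact h2 x hx hg
  | zero =>
    have : (fun w : Word N n => (0 : Word N m → ℂ) (w ∘ ⇑e ∘ Sum.inl) * g (w ∘ ⇑e ∘ Sum.inr)) = 0 := by
      funext w; simp
    rw [this]; exact Submodule.zero_mem _
  | add f f' _ _ h h' =>
    have : (fun w : Word N n => (f + f') (w ∘ ⇑e ∘ Sum.inl) * g (w ∘ ⇑e ∘ Sum.inr)) =
        (fun w => f (w ∘ ⇑e ∘ Sum.inl) * g (w ∘ ⇑e ∘ Sum.inr)) +
          fun w => f' (w ∘ ⇑e ∘ Sum.inl) * g (w ∘ ⇑e ∘ Sum.inr) := by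
      funext w; simp only [Pi.add_apply]; ring
    rw [this]; exact Submodule.add_mem _ h h'
  | smul r f _ h =>
    have : (fun w : Word N n => (r • f) (w ∘ ⇑e ∘ Sum.inl) * g (w ∘ ⇑e ∘ Sum.inr)) =
        r • fun w => f (w ∘ ⇑e ∘ Sum.inl) * g (w ∘ ⇑e ∘ Sum.inr) := by
      funext w; simp only [Pi.smul_apply, smul_eq_mul]; ring
    rw [this]; exact Submodule.smul_mem _ r h

/-- A matrix that does not kill a vector of a span does not kill some generator. [folklore] -/
theorem exists_mulVec_ne_zero_of_mem_span {X : Type*} [Fintype X] {G : Set (X → ℂ)}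
    {P : Matrix X X ℂ} {v : X → ℂ} (hv : v ∈ Submodule.span ℂ G) (h : P *ᵥ v ≠ 0) :
    ∃ x ∈ G, P *ᵥ x ≠ 0 := by
  by_contra hall
  push Not at hall
  apply h
  have hle : Submodule.span ℂ G ≤ LinearMap.ker (Matrix.mulVecLin P) :=
    Submodule.span_le.2 fun x hx => by simpa using hall x hx
  simpa using hle hv

/-- A matrix that does not kill a vector does not kill the basis vector at some point of its
support: `P v = ∑_w v(w) P e_w`. [folklore] -/
theorem exists_apply_ne_zero_and_mulVec_single_ne_zero {X : Type*} [Fintype X] [DecidableEq X]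
    {P : Matrix X X ℂ} {v : X → ℂ} (h : P *ᵥ v ≠ 0) :
    ∃ w, v w ≠ 0 ∧ P *ᵥ Pi.single w 1 ≠ 0 := by
  by_contra hall
  push Not at hall
  apply h
  have hv : v = ∑ w, v w • (Pi.single w 1 : X → ℂ) := by
    funext x
    simp [Finset.sum_apply, Pi.single_apply]
  rw [hv, Matrix.mulVec_sum]
  refine Finset.sum_eq_zero fun w _ => ?_
  rw [Matrix.mulVec_smul]
  by_cases hw : v w = 0
  · rw [hw, zero_smul]
  · rw [hall w hw, smul_zero]

/-- **The range of `P_λ` is the range of the character sum `Z_λ = ∑_π χ_λ(π) π`**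
(`P_λ v = Z_λ ((χ_λ(1)/n!) v)`, re-indexing `t ↦ t⁻¹`, `χ_λ(t⁻¹) = χ_λ(t)`). [folklore] -/
theorem wordIsotypicMatrix_mulVec_mem_range_charSum (lam : Nat.Partition n) (v : Word N n → ℂ) :
    wordIsotypicMatrix N n lam *ᵥ v ∈ LinearMap.range
      (∑ π : Equiv.Perm (Fin n), spechtCharacter ℂ lam π • wordPermRep ℂ N n π) := by
  refine ⟨(spechtCharacter ℂ lam 1 / Fintype.card (Equiv.Perm (Fin n))) • v, ?_⟩
  rw [wordIsotypicMatrix_mulVec, Literature.RepresentationTheory.FiniteGroups.isotypicProj_apply,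
    LinearMap.sum_apply]
  simp only [LinearMap.smul_apply, map_smul, smul_smul]
  refine Fintype.sum_equiv (Equiv.inv (Equiv.Perm (Fin n))) _ _ fun t => ?_
  simp only [Equiv.inv_apply, inv_inv, spechtCharacter_inv]

/-- **Words meeting `P_λ` are dominated by `λ`** (majorisation property, CVZ Rem. 3.33, in the
form: if `P_λ e_w ≠ 0` then `#{p | w p ∈ S} ≤ λ₁ + ⋯ + λ_{|S|}` for every set `S` of letters).
[cite: ChristandlVranaZuiddam2023, Rem. 3.33] -/
theorem card_filter_mem_le_of_mulVec_single_ne_zero {lam : Nat.Partition n} {w : Word N n}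
    (h : wordIsotypicMatrix N n lam *ᵥ Pi.single w 1 ≠ 0) (S : Finset (Fin N)) :
    (Finset.univ.filter fun p : Fin n => w p ∈ S).card ≤ (lam.sortedParts.take S.card).sum := by
  -- some entry `P_{w', w}` of the column is nonzero, hence `P_{w, w'} ≠ 0`
  obtain ⟨w', hw'⟩ := Function.ne_iff.1 h
  have hcol : ∀ w₀ u : Word N n, (wordIsotypicMatrix N n lam *ᵥ Pi.single w₀ 1) u =
      wordIsotypicMatrix N n lam u w₀ := fun w₀ u => by simp [Matrix.mulVec, dotProduct, Pi.single_apply]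
  rw [hcol] at hw'
  have hsym : wordIsotypicMatrix N n lam w w' ≠ 0 := by
    rw [← transpose_wordIsotypicMatrix, Matrix.transpose_apply]; exact hw'
  -- the column at `w'` is a vector of the range not vanishing at `w`
  have hx := wordIsotypicMatrix_mulVec_mem_range_charSum lam (Pi.single w' (1 : ℂ))
  refine Literature.NumberTheory.DiophantineGeometry.card_filter_mem_le_of_mem_range_charSum lam hx (u := w) ?_ S
  rw [hcol]
  exact hsym

end SpanTools

/-! ## §5 Letter counts of concatenated words and the grouping of entropies -/

section Counting

variable {a a' : ℕ} {m k n : ℕ}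

/-- `∑_{x ∈ S} #{p | w p = x} = #{p | w p ∈ S}`. [folklore] -/
theorem sum_letterCount_eq_card_filter {N : ℕ} (w : Word N n) (S : Finset (Fin N)) :
    ∑ x ∈ S, letterCount w x = (Finset.univ.filter fun p : Fin n => w p ∈ S).card := by
  classical
  rw [Finset.card_eq_sum_card_fiberwise (f := w) (t := S) (s := Finset.univ.filter fun p => w p ∈ S)
    (fun p hp => (Finset.mem_filter.1 hp).2)]
  refine Finset.sum_congr rfl fun x hx => ?_
  rw [letterCount_apply]
  congr 1
  ext p
  simp only [Finset.mem_filter, Finset.mem_univ, true_and]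
  exact ⟨fun h => ⟨h ▸ hx, h⟩, fun h => h.2⟩

/-- Letter counts of a word assembled from a `V`-word on the left block and a `W`-word on the right
block of a splitting: a `V`-letter is counted in the left word only. [folklore] -/
theorem letterCount_castAdd_of_splitting {e : Fin m ⊕ Fin k ≃ Fin n} {w : Word (a + a') n}
    {u₀ : Word a m} {v₀ : Word a' k} (hl : w ∘ ⇑e ∘ Sum.inl = Fin.castAdd a' ∘ u₀)
    (hr : w ∘ ⇑e ∘ Sum.inr = Fin.natAdd a ∘ v₀) (i : Fin a) :
    (letterCount w (Fin.castAdd a' i) : ℝ) = letterCount u₀ i := by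
  classical
  rw [letterCount_eq_sum_ite, letterCount_eq_sum_ite,
    ← Fintype.sum_equiv e (fun y => if w (e y) = Fin.castAdd a' i then (1 : ℝ) else 0) _ (fun _ => rfl),
    Fintype.sum_sum_type]
  have hl' : ∀ j, w (e (Sum.inl j)) = Fin.castAdd a' (u₀ j) := fun j => congrFun hl j
  have hr' : ∀ j, w (e (Sum.inr j)) = Fin.natAdd a (v₀ j) := fun j => congrFun hr j
  simp only [hl', hr', (Fin.castAdd_injective a a').eq_iff]
  have h0 : ∑ j : Fin k, (if Fin.natAdd a (v₀ j) = Fin.castAdd a' i then (1 : ℝ) else 0) = 0 := by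
    refine Finset.sum_eq_zero fun j _ => if_neg fun h => ?_
    have h' : a + (v₀ j : ℕ) = (i : ℕ) := congrArg Fin.val h
    have := i.isLt
    omega
  rw [h0, add_zero]

/-- Symmetrically, a `W`-letter is counted in the right word only. [folklore] -/
theorem letterCount_natAdd_of_splitting {e : Fin m ⊕ Fin k ≃ Fin n} {w : Word (a + a') n}
    {u₀ : Word a m} {v₀ : Word a' k} (hl : w ∘ ⇑e ∘ Sum.inl = Fin.castAdd a' ∘ u₀)
    (hr : w ∘ ⇑e ∘ Sum.inr = Fin.natAdd a ∘ v₀) (j : Fin a') :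
    (letterCount w (Fin.natAdd a j) : ℝ) = letterCount v₀ j := by
  classical
  rw [letterCount_eq_sum_ite, letterCount_eq_sum_ite,
    ← Fintype.sum_equiv e (fun y => if w (e y) = Fin.natAdd a j then (1 : ℝ) else 0) _ (fun _ => rfl),
    Fintype.sum_sum_type]
  have hl' : ∀ i, w (e (Sum.inl i)) = Fin.castAdd a' (u₀ i) := fun i => congrFun hl i
  have hr' : ∀ i, w (e (Sum.inr i)) = Fin.natAdd a (v₀ i) := fun i => congrFun hr i
  simp only [hl', hr', (Fin.natAdd_injective a' a).eq_iff]
  have h0 : ∑ i : Fin m, (if Fin.castAdd a' (u₀ i) = Fin.natAdd a j then (1 : ℝ) else 0) = 0 := by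
    refine Finset.sum_eq_zero fun i _ => if_neg fun h => ?_
    have h' : ((u₀ i : Fin a) : ℕ) = a + (j : ℕ) := congrArg Fin.val h
    have := (u₀ i).isLt
    omega
  rw [h0, zero_add]

/-- The entropy of the letter counts of a word assembled from a word of content `μ` on the `V`-block
(length `m`) and a word of content `ν` on the `W`-block (length `k`), `n = m + k`:
`H(c/n) = (η(m/n) + η(k/n))/log 2 + (m/n) H(μ̄) + (k/n) H(ν̄)` (the grouping rule).
[cite: ChristandlVranaZuiddam2023, Lemma 3.10.2] -/
theorem shannonEntropy_letterCount_of_splitting {e : Fin m ⊕ Fin k ≃ Fin n} {w : Word (a + a') n}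
    {u₀ : Word a m} {v₀ : Word a' k} (hl : w ∘ ⇑e ∘ Sum.inl = Fin.castAdd a' ∘ u₀)
    (hr : w ∘ ⇑e ∘ Sum.inr = Fin.natAdd a ∘ v₀) {mu : Nat.Partition m} {nu : Nat.Partition k}
    (hmu : mu.parts.card ≤ a) (hnu : nu.parts.card ≤ a')
    (hu₀ : ∀ i, letterCount u₀ i = mu.sortedParts.getD i 0)
    (hv₀ : ∀ j, letterCount v₀ j = nu.sortedParts.getD j 0) :
    shannonEntropy (fun x : Fin (a + a') => (letterCount w x : ℝ) / n) =
      (Real.negMulLog ((m : ℝ) / n) + Real.negMulLog ((k : ℝ) / n)) / Real.log 2 +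
        (m : ℝ) / n * partitionEntropy mu + (k : ℝ) / n * partitionEntropy nu := by
  rw [shannonEntropy_def, Fin.sum_univ_add]
  simp only [letterCount_castAdd_of_splitting hl hr, letterCount_natAdd_of_splitting hl hr, hu₀, hv₀]
  -- grouping on each block
  have hsm : ∑ i : Fin a, ((mu.sortedParts.getD i 0 : ℕ) : ℝ) = m := by
    exact_mod_cast sum_sortedParts_getD hmu
  have hsn : ∑ j : Fin a', ((nu.sortedParts.getD j 0 : ℕ) : ℝ) = k := by
    exact_mod_cast sum_sortedParts_getD hnu
  have hz : ∀ {b : ℕ} {l : List ℕ} {c : ℕ}, (∑ i : Fin b, ((l.getD i 0 : ℕ) : ℝ) = c) → (c : ℝ) = 0 →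
      ∀ i : Fin b, ((l.getD i 0 : ℕ) : ℝ) = 0 := by
    intro b l c hs hc i
    have hnn : ∀ i ∈ (Finset.univ : Finset (Fin b)), (0 : ℝ) ≤ ((l.getD i 0 : ℕ) : ℝ) :=
      fun i _ => Nat.cast_nonneg _
    have := (Finset.sum_eq_zero_iff_of_nonneg hnn).1 (hs.trans hc) i (Finset.mem_univ _)
    exact this
  rw [sum_negMulLog_div_eq_grouping hsm (hz hsm) (n : ℝ), sum_negMulLog_div_eq_grouping hsn (hz hsn) (n : ℝ),
    ← shannonEntropy_sortedParts_getD hmu, ← shannonEntropy_sortedParts_getD hnu, shannonEntropy_def,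
    shannonEntropy_def]
  have hl2 : Real.log 2 ≠ 0 := (Real.log_pos one_lt_two).ne'
  field_simp
  ring

end Counting

/-! ## §6 The heart: a shape meeting a concatenation of embedded isotypic vectors is dominated -/

section Heart

variable {a a' : ℕ} {m k n : ℕ}

/-- **Entropy bound for shapes meeting a concatenation product** (the representation-theoretic core
of CVZ Lemma 3.11, in the elementary "dominance" form replacing the Littlewood–Richardson argument
of Lemma 3.10.2): let `f` lie in the span of the `Φ_V`-embedded `GL_a`-translates of highest-weight
vectors of weight `μ ⊢ m` and `g` in the span of the `Φ_W`-embedded `GL_{a'}`-translates of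
highest-weight vectors of weight `ν ⊢ k`; if `P_λ` (`λ ⊢ n`, alphabet `Fin (a + a')`) does not kill
the concatenation product `w ↦ f(w|_left) g(w|_right)` along a splitting `[m] ⊔ [k] ≃ [n]`, then
`H(λ̄) ≤ h-term + (m/n) H(μ̄) + (k/n) H(ν̄)` with `h-term = (η(m/n) + η(k/n))/log 2 = h(m/n)`.
Proof: pass to a pair of generators (bilinearity), transport the two translates to one block-diagonal
matrix `B = Φ_V g Φ_Vᵀ + Φ_W h Φ_Wᵀ` acting by `B^{⊗n}` (which commutes with `P_λ`), find a word in
the support of `ξ̂ ⋆ η̂` meeting `P_λ`; it has content `(μ on V, ν on W)` and is dominated by `λ`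
(majorisation), and the Shannon entropy is Schur-concave (`partitionEntropy_le_of_dominated`).
[cite: ChristandlVranaZuiddam2023, Lemma 3.10.2 and Lemma 3.11] -/
theorem partitionEntropy_le_of_mulVec_conc_ne_zero (e : Fin m ⊕ Fin k ≃ Fin n)
    {lam : Nat.Partition n} {mu : Nat.Partition m} {nu : Nat.Partition k}
    {f : Word (a + a') m → ℂ} {g : Word (a + a') k → ℂ}
    (hf : f ∈ Submodule.span ℂ {x : Word (a + a') m → ℂ | ∃ (g₀ : GL (Fin a) ℂ) (ξ : Word a m → ℂ),
      ξ ∈ highestWeightSpace (wordRep ℂ a m) (Weight.ofPartition a mu) ∧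
      x = powMat ((1 : Matrix (Fin (a + a')) (Fin (a + a')) ℂ).submatrix id (Fin.castAdd a')) m *ᵥ
        wordRep ℂ a m g₀ ξ})
    (hg : g ∈ Submodule.span ℂ {y : Word (a + a') k → ℂ | ∃ (h₀ : GL (Fin a') ℂ) (η : Word a' k → ℂ),
      η ∈ highestWeightSpace (wordRep ℂ a' k) (Weight.ofPartition a' nu) ∧
      y = powMat ((1 : Matrix (Fin (a + a')) (Fin (a + a')) ℂ).submatrix id (Fin.natAdd a)) k *ᵥ
        wordRep ℂ a' k h₀ η})
    (h : wordIsotypicMatrix (a + a') n lam *ᵥ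
      (fun w : Word (a + a') n => f (w ∘ ⇑e ∘ Sum.inl) * g (w ∘ ⇑e ∘ Sum.inr)) ≠ 0) :
    partitionEntropy lam ≤
      (Real.negMulLog ((m : ℝ) / n) + Real.negMulLog ((k : ℝ) / n)) / Real.log 2 +
        (m : ℝ) / n * partitionEntropy mu + (k : ℝ) / n * partitionEntropy nu := by
  classical
  -- Step 1: a pair of generators
  obtain ⟨x, hx, hPx⟩ := exists_mulVec_ne_zero_of_mem_span (conc₁_mem_span e hf hg) h
  obtain ⟨x₁, ⟨g₀, ξ, hξ, rfl⟩, y₁, ⟨h₀, η, hη, rfl⟩, rfl⟩ := hx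
  -- Step 2: both embedded translates come from one block-diagonal matrix `B`
  have hV : powMat ((1 : Matrix (Fin (a + a')) (Fin (a + a')) ℂ).submatrix id (Fin.castAdd a')) m *ᵥ
      wordRep ℂ a m g₀ ξ =
      powMat ((1 : Matrix (Fin (a + a')) (Fin (a + a')) ℂ).submatrix id (Fin.castAdd a') *
          (g₀ : Matrix (Fin a) (Fin a) ℂ) *
          ((1 : Matrix (Fin (a + a')) (Fin (a + a')) ℂ).submatrix id (Fin.castAdd a'))ᵀ +
        (1 : Matrix (Fin (a + a')) (Fin (a + a')) ℂ).submatrix id (Fin.natAdd a) *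
          (h₀ : Matrix (Fin a') (Fin a') ℂ) *
          ((1 : Matrix (Fin (a + a')) (Fin (a + a')) ℂ).submatrix id (Fin.natAdd a))ᵀ) m *ᵥ
        (powMat ((1 : Matrix (Fin (a + a')) (Fin (a + a')) ℂ).submatrix id (Fin.castAdd a')) m *ᵥ ξ) := by
    rw [wordRep_eq_powMat_mulVec, Matrix.mulVec_mulVec, Matrix.mulVec_mulVec, ← powMat_mul, ← powMat_mul,
      blockDiag_mul_inclV]
  have hW : powMat ((1 : Matrix (Fin (a + a')) (Fin (a + a')) ℂ).submatrix id (Fin.natAdd a)) k *ᵥ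
      wordRep ℂ a' k h₀ η =
      powMat ((1 : Matrix (Fin (a + a')) (Fin (a + a')) ℂ).submatrix id (Fin.castAdd a') *
          (g₀ : Matrix (Fin a) (Fin a) ℂ) *
          ((1 : Matrix (Fin (a + a')) (Fin (a + a')) ℂ).submatrix id (Fin.castAdd a'))ᵀ +
        (1 : Matrix (Fin (a + a')) (Fin (a + a')) ℂ).submatrix id (Fin.natAdd a) *
          (h₀ : Matrix (Fin a') (Fin a') ℂ) *
          ((1 : Matrix (Fin (a + a')) (Fin (a + a')) ℂ).submatrix id (Fin.natAdd a))ᵀ) k *ᵥ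
        (powMat ((1 : Matrix (Fin (a + a')) (Fin (a + a')) ℂ).submatrix id (Fin.natAdd a)) k *ᵥ η) := by
    rw [wordRep_eq_powMat_mulVec, Matrix.mulVec_mulVec, Matrix.mulVec_mulVec, ← powMat_mul, ← powMat_mul,
      blockDiag_mul_inclW]
  rw [hV, hW, ← powMat_mulVec_conc₁ _ e
    (powMat ((1 : Matrix (Fin (a + a')) (Fin (a + a')) ℂ).submatrix id (Fin.castAdd a')) m *ᵥ ξ)
    (powMat ((1 : Matrix (Fin (a + a')) (Fin (a + a')) ℂ).submatrix id (Fin.natAdd a)) k *ᵥ η)] at hPx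
  -- Step 3: `P_λ` commutes with `B^{⊗n}`
  have hPv : wordIsotypicMatrix (a + a') n lam *ᵥ (fun w : Word (a + a') n =>
      (powMat ((1 : Matrix (Fin (a + a')) (Fin (a + a')) ℂ).submatrix id (Fin.castAdd a')) m *ᵥ ξ)
        (w ∘ ⇑e ∘ Sum.inl) *
      (powMat ((1 : Matrix (Fin (a + a')) (Fin (a + a')) ℂ).submatrix id (Fin.natAdd a)) k *ᵥ η)
        (w ∘ ⇑e ∘ Sum.inr)) ≠ 0 := by
    intro h0
    apply hPx
    rw [Matrix.mulVec_mulVec, ← tensorPowerMatrix_eq_powMat,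
      Literature.RepresentationTheory.FiniteGroups.wordIsotypicMatrix_mul_tensorPowerMatrix,
      ← Matrix.mulVec_mulVec, tensorPowerMatrix_eq_powMat, h0, Matrix.mulVec_zero]
  -- Step 4: a word of the support meeting `P_λ`; its two halves and their contents
  obtain ⟨w, hw, hPw⟩ := exists_apply_ne_zero_and_mulVec_single_ne_zero hPv
  obtain ⟨u₀, hu₀, hξu⟩ := exists_eq_comp_of_powMat_submatrix_mulVec_ne_zero ξ (left_ne_zero_of_mul hw)
  obtain ⟨v₀, hv₀, hηv⟩ := exists_eq_comp_of_powMat_submatrix_mulVec_ne_zero η (right_ne_zero_of_mul hw)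
  have hcu : ∀ i, letterCount u₀ i = mu.sortedParts.getD i 0 := by
    by_contra hall
    exact hξu (apply_eq_zero_of_mem_highestWeightSpace_ofPartition hξ hall)
  have hcv : ∀ j, letterCount v₀ j = nu.sortedParts.getD j 0 := by
    by_contra hall
    exact hηv (apply_eq_zero_of_mem_highestWeightSpace_ofPartition hη hall)
  have hξ0 : ξ ≠ 0 := by rintro rfl; exact hξu rfl
  have hη0 : η ≠ 0 := by rintro rfl; exact hηv rfl
  have hmu := card_parts_le_of_mem_highestWeightSpace_ne_zero hξ hξ0
  have hnu := card_parts_le_of_mem_highestWeightSpace_ne_zero hη hη0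
  -- Step 5: domination and Schur-concavity
  have hdom : ∀ S : Finset (Fin (a + a')), ∑ x ∈ S, letterCount w x ≤ (lam.sortedParts.take S.card).sum := by
    intro S
    rw [sum_letterCount_eq_card_filter]
    exact card_filter_mem_le_of_mulVec_single_ne_zero hPw S
  have key := partitionEntropy_le_of_dominated lam (letterCount w) (sum_letterCount w) hdom
  rw [shannonEntropy_letterCount_of_splitting hu₀ hv₀ hmu hnu hcu hcv] at key
  exact key

end Heart

/-! ## §7 Inclusion matrices acting on tensors; relabelling a direct sum -/

section InclAct

variable {α β γ α' β' γ' : Type*} [Fintype α] [Fintype β] [Fintype γ] [DecidableEq α'] [DecidableEq β']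
  [DecidableEq γ']

/-- The action of three inclusion matrices at an included position. [folklore] -/
theorem actTensor_submatrix_one_apply {φ₁ : α → α'} {φ₂ : β → β'} {φ₃ : γ → γ'}
    (h₁ : Function.Injective φ₁) (h₂ : Function.Injective φ₂) (h₃ : Function.Injective φ₃)
    (X : α → β → γ → ℂ) (i : α) (j : β) (l : γ) :
    actTensor ((1 : Matrix α' α' ℂ).submatrix id φ₁) ((1 : Matrix β' β' ℂ).submatrix id φ₂)
      ((1 : Matrix γ' γ' ℂ).submatrix id φ₃) X (φ₁ i) (φ₂ j) (φ₃ l) = X i j l := by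
  have e₁ : ∀ x i, ((1 : Matrix α' α' ℂ).submatrix id φ₁) x i = (1 : Matrix α' α' ℂ) x (φ₁ i) := fun _ _ => rfl
  have e₂ : ∀ y j, ((1 : Matrix β' β' ℂ).submatrix id φ₂) y j = (1 : Matrix β' β' ℂ) y (φ₂ j) := fun _ _ => rfl
  have e₃ : ∀ z l, ((1 : Matrix γ' γ' ℂ).submatrix id φ₃) z l = (1 : Matrix γ' γ' ℂ) z (φ₃ l) := fun _ _ => rfl
  simp only [actTensor_apply, e₁, e₂, e₃]
  rw [Finset.sum_eq_single_of_mem i (Finset.mem_univ _)]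
  · rw [Finset.sum_eq_single_of_mem j (Finset.mem_univ _)]
    · rw [Finset.sum_eq_single_of_mem l (Finset.mem_univ _)]
      · simp only [Matrix.one_apply_eq, one_mul]
      · intro l' _ hl'
        rw [Matrix.one_apply_ne (fun e => hl' (h₃ e).symm), mul_zero, zero_mul]
    · intro j' _ hj'
      simp only [Matrix.one_apply_ne (fun e => hj' (h₂ e).symm), mul_zero, zero_mul, Finset.sum_const_zero]
  · intro i' _ hi'
    simp only [Matrix.one_apply_ne (fun e => hi' (h₁ e).symm), zero_mul, Finset.sum_const_zero]

/-- The action of three inclusion matrices vanishes off the image in the first leg. [folklore] -/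
theorem actTensor_submatrix_one_apply_eq_zero₁ {φ₁ : α → α'} (φ₂ : β → β') (φ₃ : γ → γ')
    (X : α → β → γ → ℂ) {x : α'} (hx : ∀ i, x ≠ φ₁ i) (y : β') (z : γ') :
    actTensor ((1 : Matrix α' α' ℂ).submatrix id φ₁) ((1 : Matrix β' β' ℂ).submatrix id φ₂)
      ((1 : Matrix γ' γ' ℂ).submatrix id φ₃) X x y z = 0 := by
  have e₁ : ∀ x i, ((1 : Matrix α' α' ℂ).submatrix id φ₁) x i = (1 : Matrix α' α' ℂ) x (φ₁ i) := fun _ _ => rfl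
  simp only [actTensor_apply, e₁]
  exact Finset.sum_eq_zero fun i _ => by simp [Matrix.one_apply_ne (hx i)]

/-- The action of three inclusion matrices vanishes off the image in the second leg. [folklore] -/
theorem actTensor_submatrix_one_apply_eq_zero₂ (φ₁ : α → α') {φ₂ : β → β'} (φ₃ : γ → γ')
    (X : α → β → γ → ℂ) (x : α') {y : β'} (hy : ∀ j, y ≠ φ₂ j) (z : γ') :
    actTensor ((1 : Matrix α' α' ℂ).submatrix id φ₁) ((1 : Matrix β' β' ℂ).submatrix id φ₂)
      ((1 : Matrix γ' γ' ℂ).submatrix id φ₃) X x y z = 0 := by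
  have e₂ : ∀ y j, ((1 : Matrix β' β' ℂ).submatrix id φ₂) y j = (1 : Matrix β' β' ℂ) y (φ₂ j) := fun _ _ => rfl
  simp only [actTensor_apply, e₂]
  exact Finset.sum_eq_zero fun i _ => Finset.sum_eq_zero fun j _ => by simp [Matrix.one_apply_ne (hy j)]

/-- The action of three inclusion matrices vanishes off the image in the third leg. [folklore] -/
theorem actTensor_submatrix_one_apply_eq_zero₃ (φ₁ : α → α') (φ₂ : β → β') {φ₃ : γ → γ'}
    (X : α → β → γ → ℂ) (x : α') (y : β') {z : γ'} (hz : ∀ l, z ≠ φ₃ l) :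
    actTensor ((1 : Matrix α' α' ℂ).submatrix id φ₁) ((1 : Matrix β' β' ℂ).submatrix id φ₂)
      ((1 : Matrix γ' γ' ℂ).submatrix id φ₃) X x y z = 0 := by
  have e₃ : ∀ z l, ((1 : Matrix γ' γ' ℂ).submatrix id φ₃) z l = (1 : Matrix γ' γ' ℂ) z (φ₃ l) := fun _ _ => rfl
  simp only [actTensor_apply, e₃]
  exact Finset.sum_eq_zero fun i _ => Finset.sum_eq_zero fun j _ =>
    Finset.sum_eq_zero fun l _ => by simp [Matrix.one_apply_ne (hz l)]

end InclAct

section RelabelSum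

/-- The two letter blocks are disjoint: `castAdd i ≠ natAdd j` (a private copy of a lemma also
proved in `Literature.Analysis.FluidPDE`, to keep the import closure topical). [folklore] -/
private theorem castAdd_ne_natAdd_aux {a a' : ℕ} (i : Fin a) (j : Fin a') : Fin.castAdd a' i ≠ Fin.natAdd a j := by
  intro h
  have h' : (i : ℕ) = a + (j : ℕ) := congrArg Fin.val h
  have := i.isLt
  omega

universe u

variable {ι κ μ ι' κ' μ' : Type u}
variable {a b c a' b' c' : ℕ}

/-- The combined relabelling `ι ⊕ ι' ≃ Fin a ⊕ Fin a' ≃ Fin (a + a')` sends `inl i` to the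
`V`-letter `castAdd (e i)`. [folklore] -/
theorem sumCongr_trans_finSumFinEquiv_inl (eι : ι ≃ Fin a) (eι' : ι' ≃ Fin a') (i : ι) :
    ((eι.sumCongr eι').trans finSumFinEquiv) (Sum.inl i) = Fin.castAdd a' (eι i) := by
  simp [Equiv.trans_apply, Equiv.sumCongr_apply]

/-- The combined relabelling sends `inr i'` to the `W`-letter `natAdd (e' i')`. [folklore] -/
theorem sumCongr_trans_finSumFinEquiv_inr (eι : ι ≃ Fin a) (eι' : ι' ≃ Fin a') (i' : ι') :
    ((eι.sumCongr eι').trans finSumFinEquiv) (Sum.inr i') = Fin.natAdd a (eι' i') := by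
  simp [Equiv.trans_apply, Equiv.sumCongr_apply]

variable [Fintype ι] [Fintype κ] [Fintype μ] [Fintype ι'] [Fintype κ'] [Fintype μ']
  [DecidableEq ι] [DecidableEq κ] [DecidableEq μ] [DecidableEq ι'] [DecidableEq κ'] [DecidableEq μ']

/-- **Relabelling a direct sum onto the concatenated alphabets yields the sum of the two embedded
(relabelled) summands**: with `E = (e ⊕ e') ∘ finSumFin` on each leg,
`E·(s ⊕ t) = Φ_V·(e·s) + Φ_W·(e'·t)`. [folklore] -/
theorem actTensor_relabel_directSumTensor (eι : ι ≃ Fin a) (eκ : κ ≃ Fin b) (eμ : μ ≃ Fin c)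
    (eι' : ι' ≃ Fin a') (eκ' : κ' ≃ Fin b') (eμ' : μ' ≃ Fin c') (s : ι → κ → μ → ℂ) (t : ι' → κ' → μ' → ℂ) :
    actTensor ((1 : Matrix (ι ⊕ ι') (ι ⊕ ι') ℂ).submatrix (⇑((eι.sumCongr eι').trans finSumFinEquiv).symm) id)
      ((1 : Matrix (κ ⊕ κ') (κ ⊕ κ') ℂ).submatrix (⇑((eκ.sumCongr eκ').trans finSumFinEquiv).symm) id)
      ((1 : Matrix (μ ⊕ μ') (μ ⊕ μ') ℂ).submatrix (⇑((eμ.sumCongr eμ').trans finSumFinEquiv).symm) id)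
      (directSumTensor s t) =
    actTensor ((1 : Matrix (Fin (a + a')) (Fin (a + a')) ℂ).submatrix id (Fin.castAdd a'))
        ((1 : Matrix (Fin (b + b')) (Fin (b + b')) ℂ).submatrix id (Fin.castAdd b'))
        ((1 : Matrix (Fin (c + c')) (Fin (c + c')) ℂ).submatrix id (Fin.castAdd c'))
        (actTensor ((1 : Matrix ι ι ℂ).submatrix (⇑eι.symm) id) ((1 : Matrix κ κ ℂ).submatrix (⇑eκ.symm) id)
          ((1 : Matrix μ μ ℂ).submatrix (⇑eμ.symm) id) s) +
      actTensor ((1 : Matrix (Fin (a + a')) (Fin (a + a')) ℂ).submatrix id (Fin.natAdd a))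
        ((1 : Matrix (Fin (b + b')) (Fin (b + b')) ℂ).submatrix id (Fin.natAdd b))
        ((1 : Matrix (Fin (c + c')) (Fin (c + c')) ℂ).submatrix id (Fin.natAdd c))
        (actTensor ((1 : Matrix ι' ι' ℂ).submatrix (⇑eι'.symm) id) ((1 : Matrix κ' κ' ℂ).submatrix (⇑eκ'.symm) id)
          ((1 : Matrix μ' μ' ℂ).submatrix (⇑eμ'.symm) id) t) := by
  set E₁ := (eι.sumCongr eι').trans finSumFinEquiv with hE₁
  set E₂ := (eκ.sumCongr eκ').trans finSumFinEquiv with hE₂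
  set E₃ := (eμ.sumCongr eμ').trans finSumFinEquiv with hE₃
  have hVa : Function.Injective (Fin.castAdd a' : Fin a → Fin (a + a')) := Fin.castAdd_injective a a'
  have hVb : Function.Injective (Fin.castAdd b' : Fin b → Fin (b + b')) := Fin.castAdd_injective b b'
  have hVc : Function.Injective (Fin.castAdd c' : Fin c → Fin (c + c')) := Fin.castAdd_injective c c'
  have hWa : Function.Injective (Fin.natAdd a : Fin a' → Fin (a + a')) := Fin.natAdd_injective a' a
  have hWb : Function.Injective (Fin.natAdd b : Fin b' → Fin (b + b')) := Fin.natAdd_injective b' b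
  have hWc : Function.Injective (Fin.natAdd c : Fin c' → Fin (c + c')) := Fin.natAdd_injective c' c
  funext x y z
  rw [actTensor_relabel_apply, Pi.add_apply, Pi.add_apply, Pi.add_apply]
  obtain ⟨xx, rfl⟩ := E₁.surjective x
  obtain ⟨yy, rfl⟩ := E₂.surjective y
  obtain ⟨zz, rfl⟩ := E₃.surjective z
  simp only [Equiv.symm_apply_apply]
  rcases xx with i | i' <;> rcases yy with j | j' <;> rcases zz with l | l' <;>
    simp only [hE₁, hE₂, hE₃, sumCongr_trans_finSumFinEquiv_inl, sumCongr_trans_finSumFinEquiv_inr,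
      directSumTensor_inl, directSumTensor_inr, directSumTensor_inl_inr, directSumTensor_inr_inl,
      actTensor_submatrix_one_apply hVa hVb hVc, actTensor_submatrix_one_apply hWa hWb hWc,
      actTensor_submatrix_one_apply_eq_zero₁ _ _ _ (fun i => castAdd_ne_natAdd_aux _ _),
      actTensor_submatrix_one_apply_eq_zero₁ _ _ _ (fun i => (castAdd_ne_natAdd_aux _ _).symm),
      actTensor_submatrix_one_apply_eq_zero₂ _ _ _ _ (fun i => castAdd_ne_natAdd_aux _ _),
      actTensor_submatrix_one_apply_eq_zero₂ _ _ _ _ (fun i => (castAdd_ne_natAdd_aux _ _).symm),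
      actTensor_submatrix_one_apply_eq_zero₃ _ _ _ _ _ (fun i => castAdd_ne_natAdd_aux _ _),
      actTensor_submatrix_one_apply_eq_zero₃ _ _ _ _ _ (fun i => (castAdd_ne_natAdd_aux _ _).symm),
      actTensor_relabel_apply, Equiv.symm_apply_apply, add_zero, zero_add] <;>
    rfl

end RelabelSum

/-! ## §8 Columns of acted tensors, the isotypic decomposition of a power, Lemma 3.12 -/

section Columns

variable {α β γ α' β' γ' : Type*} [Fintype α] [Fintype β] [Fintype γ]

/-- Leg-1 columns of `(A ⊗ B ⊗ C)·X` are `A` applied to combinations of leg-1 columns of `X`.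
[folklore] -/
theorem col₁_actTensor (A : Matrix α' α ℂ) (B : Matrix β' β ℂ) (C : Matrix γ' γ ℂ) (X : α → β → γ → ℂ)
    (y : β') (z : γ') :
    (fun x => actTensor A B C X x y z) = A *ᵥ fun x' => ∑ y', ∑ z', B y y' * C z z' * X x' y' z' := by
  funext x
  simp only [actTensor_apply, Matrix.mulVec, dotProduct, Finset.mul_sum]
  exact Finset.sum_congr rfl fun _ _ => Finset.sum_congr rfl fun _ _ =>
    Finset.sum_congr rfl fun _ _ => by ring

/-- Leg-2 columns of `(A ⊗ B ⊗ C)·X`. [folklore] -/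
theorem col₂_actTensor (A : Matrix α' α ℂ) (B : Matrix β' β ℂ) (C : Matrix γ' γ ℂ) (X : α → β → γ → ℂ)
    (x : α') (z : γ') :
    (fun y => actTensor A B C X x y z) = B *ᵥ fun y' => ∑ x', ∑ z', A x x' * C z z' * X x' y' z' := by
  funext y
  simp only [actTensor_apply, Matrix.mulVec, dotProduct, Finset.mul_sum]
  rw [Finset.sum_comm]
  exact Finset.sum_congr rfl fun _ _ => Finset.sum_congr rfl fun _ _ =>
    Finset.sum_congr rfl fun _ _ => by ring

/-- Leg-3 columns of `(A ⊗ B ⊗ C)·X`. [folklore] -/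
theorem col₃_actTensor (A : Matrix α' α ℂ) (B : Matrix β' β ℂ) (C : Matrix γ' γ ℂ) (X : α → β → γ → ℂ)
    (x : α') (y : β') :
    (fun z => actTensor A B C X x y z) = C *ᵥ fun z' => ∑ x', ∑ y', A x x' * B y y' * X x' y' z' := by
  funext z
  simp only [actTensor_apply, Matrix.mulVec, dotProduct, Finset.mul_sum]
  rw [Finset.sum_congr rfl fun x' _ => Finset.sum_comm, Finset.sum_comm]
  exact Finset.sum_congr rfl fun _ _ => Finset.sum_congr rfl fun _ _ =>
    Finset.sum_congr rfl fun _ _ => by ring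

/-- The action is additive in the tensor over finite sums. [folklore] -/
theorem actTensor_tensor_sum {δ : Type*} (s : Finset δ) (A : Matrix α' α ℂ) (B : Matrix β' β ℂ)
    (C : Matrix γ' γ ℂ) (T : δ → α → β → γ → ℂ) :
    actTensor A B C (∑ i ∈ s, T i) = ∑ i ∈ s, actTensor A B C (T i) := by
  classical
  induction s using Finset.induction_on with
  | empty => rw [Finset.sum_empty, Finset.sum_empty, actTensor_zero]
  | insert x s hx ih => rw [Finset.sum_insert hx, Finset.sum_insert hx, actTensor_tensor_add, ih]

end Columns

section Decomposition

variable {a b c m : ℕ}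

/-- **The isotypic decomposition of a 3-leg tensor on words** (CVZ §3.1 (sw) on each leg):
`Y = ∑_{μ₁ μ₂ μ₃} (P_{μ₁} ⊗ P_{μ₂} ⊗ P_{μ₃}) Y`. [cite: ChristandlVranaZuiddam2023, §3.1 (sw)] -/
theorem eq_sum_actTensor_wordIsotypicMatrix (Y : Word a m → Word b m → Word c m → ℂ) :
    Y = ∑ mu₁ : Nat.Partition m, ∑ mu₂ : Nat.Partition m, ∑ mu₃ : Nat.Partition m,
      actTensor (wordIsotypicMatrix a m mu₁) (wordIsotypicMatrix b m mu₂) (wordIsotypicMatrix c m mu₃) Y := by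
  conv_lhs => rw [← actTensor_one Y, ← sum_wordIsotypicMatrix a m, ← sum_wordIsotypicMatrix b m,
    ← sum_wordIsotypicMatrix c m, actTensor_sum_fst]
  refine Finset.sum_congr rfl fun mu₁ _ => ?_
  rw [actTensor_sum_snd]
  refine Finset.sum_congr rfl fun mu₂ _ => ?_
  rw [actTensor_sum_thd]

end Decomposition

section EntropyTrick

/-- **The entropy trick, inequality form** (CVZ Lemma 3.12, quoting [Str91]): for `0 ≤ p ≤ 1` and
real `x, y`, `h(p) + p x + (1-p) y ≤ log₂(2^x + 2^y)`, `h(p) = (η(p) + η(1-p))/log 2` (Gibbs'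
inequality for `(p, 1-p)` against `(2^x, 2^y)/(2^x + 2^y)`). [cite: ChristandlVranaZuiddam2023, Lemma 3.12] -/
theorem binEntropy_add_weights_le_logb (x y : ℝ) {p : ℝ} (hp0 : 0 ≤ p) (hp1 : p ≤ 1) :
    (Real.negMulLog p + Real.negMulLog (1 - p)) / Real.log 2 + p * x + (1 - p) * y ≤
      Real.logb 2 ((2 : ℝ) ^ x + (2 : ℝ) ^ y) := by
  have hA : (0 : ℝ) < 2 ^ x := Real.rpow_pos_of_pos two_pos x
  have hB : (0 : ℝ) < 2 ^ y := Real.rpow_pos_of_pos two_pos y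
  have hS : (0 : ℝ) < 2 ^ x + 2 ^ y := add_pos hA hB
  have hl2 : 0 < Real.log 2 := Real.log_pos one_lt_two
  set P : Fin 2 → ℝ := ![p, 1 - p] with hP
  set Q : Fin 2 → ℝ := ![(2 : ℝ) ^ x / (2 ^ x + 2 ^ y), (2 : ℝ) ^ y / (2 ^ x + 2 ^ y)] with hQ
  have hP0 : ∀ i, 0 ≤ P i := by
    intro i; fin_cases i <;> simp [hP] <;> linarith
  have hP1 : ∑ i, P i = 1 := by simp [hP, Fin.sum_univ_two]
  have hQ0 : ∀ i, 0 ≤ Q i := by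
    intro i; fin_cases i <;> simp [hQ] <;> positivity
  have hQ1 : ∑ i, Q i ≤ 1 := by
    simp only [hQ, Fin.sum_univ_two, Matrix.cons_val_zero, Matrix.cons_val_one]
    rw [← add_div, div_self hS.ne']
  have hPQ : ∀ i, P i ≠ 0 → 0 < Q i := by
    intro i _; fin_cases i <;> simp [hQ] <;> positivity
  have hG := shannonEntropy_le_sum_mul_neg_logb hP0 hP1 hQ0 hQ1 hPQ
  have hH : shannonEntropy P = (Real.negMulLog p + Real.negMulLog (1 - p)) / Real.log 2 := by
    simp [shannonEntropy_def, hP, Fin.sum_univ_two]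
  rw [hH] at hG
  simp only [hP, hQ, Fin.sum_univ_two, Matrix.cons_val_zero, Matrix.cons_val_one] at hG
  have hlx : Real.log ((2 : ℝ) ^ x / (2 ^ x + 2 ^ y)) = x * Real.log 2 - Real.log (2 ^ x + 2 ^ y) := by
    rw [Real.log_div hA.ne' hS.ne', Real.log_rpow two_pos]
  have hly : Real.log ((2 : ℝ) ^ y / (2 ^ x + 2 ^ y)) = y * Real.log 2 - Real.log (2 ^ x + 2 ^ y) := by
    rw [Real.log_div hB.ne' hS.ne', Real.log_rpow two_pos]
  rw [hlx, hly] at hG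
  rw [Real.logb]
  have key : p * (-(x * Real.log 2 - Real.log (2 ^ x + 2 ^ y)) / Real.log 2) +
      (1 - p) * (-(y * Real.log 2 - Real.log (2 ^ x + 2 ^ y)) / Real.log 2) =
      Real.log (2 ^ x + 2 ^ y) / Real.log 2 - p * x - (1 - p) * y := by
    field_simp
    ring
  rw [key] at hG
  linarith

/-- `log₂` is monotone in the form used below: `y ≤ log₂(A + 2^y)` for `A ≥ 0`. [folklore] -/
theorem le_logb_add_rpow {A : ℝ} (hA : 0 ≤ A) (y : ℝ) : y ≤ Real.logb 2 (A + (2 : ℝ) ^ y) := by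
  have hB : (0 : ℝ) < 2 ^ y := Real.rpow_pos_of_pos two_pos y
  calc y = Real.logb 2 ((2 : ℝ) ^ y) := (Real.logb_rpow two_pos (by norm_num)).symm
    _ ≤ Real.logb 2 (A + (2 : ℝ) ^ y) :=
        Real.logb_le_logb_of_le one_lt_two hB (by linarith)

end EntropyTrick

/-! ## §9 Leg columns of embedded projected powers; per-leg extraction -/

section LegColumns

variable {a N b c m : ℕ} {β' γ' α' : Type*}

/-- **Leg-1 columns of an embedded projected tensor lie in the span of the embedded translates of
highest-weight vectors** (`Φ` any letter matrix; range of `P_μ` = span of the translates,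
`range_isotypicProj_wordPermRep`). [cite: FultonHarrisGTM129, Thm. 6.3] -/
theorem col₁_mem_span_embedded (Φ : Matrix (Fin N) (Fin a) ℂ) (Φ₂ : Matrix β' (Word b m) ℂ)
    (Φ₃ : Matrix γ' (Word c m) ℂ) (mu : Nat.Partition m) (B : Matrix (Word b m) (Word b m) ℂ)
    (C : Matrix (Word c m) (Word c m) ℂ) (Xs : Word a m → Word b m → Word c m → ℂ) (y : β') (z : γ') :
    (fun x' => actTensor (powMat Φ m) Φ₂ Φ₃ (actTensor (wordIsotypicMatrix a m mu) B C Xs) x' y z) ∈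
      Submodule.span ℂ {x : Word N m → ℂ | ∃ (g₀ : GL (Fin a) ℂ) (ξ : Word a m → ℂ),
        ξ ∈ highestWeightSpace (wordRep ℂ a m) (Weight.ofPartition a mu) ∧
        x = powMat Φ m *ᵥ wordRep ℂ a m g₀ ξ} := by
  rw [col₁_actTensor]
  have hGsum : (fun x' => ∑ y', ∑ z', Φ₂ y y' * Φ₃ z z' * actTensor (wordIsotypicMatrix a m mu) B C Xs x' y' z') =
      ∑ y', ∑ z', (Φ₂ y y' * Φ₃ z z') • fun x' => actTensor (wordIsotypicMatrix a m mu) B C Xs x' y' z' := by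
    funext x'; simp only [Finset.sum_apply, Pi.smul_apply, smul_eq_mul]
  have hGmem : (fun x' => ∑ y', ∑ z', Φ₂ y y' * Φ₃ z z' * actTensor (wordIsotypicMatrix a m mu) B C Xs x' y' z') ∈
      Submodule.span ℂ (Set.range fun p : GL (Fin a) ℂ ×
        highestWeightSpace (wordRep ℂ a m) (Weight.ofPartition a mu) => wordRep ℂ a m p.1 (p.2 : Word a m → ℂ)) := by
    rw [← range_isotypicProj_wordPermRep, hGsum]
    refine Submodule.sum_mem _ fun y' _ => Submodule.sum_mem _ fun z' _ => Submodule.smul_mem _ _ ?_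
    rw [col₁_actTensor, wordIsotypicMatrix_mulVec]
    exact ⟨_, rfl⟩
  have hmap := Submodule.mem_map_of_mem (f := Matrix.mulVecLin (powMat Φ m)) hGmem
  rw [Submodule.map_span] at hmap
  refine Submodule.span_mono ?_ hmap
  rintro _ ⟨_, ⟨⟨g₀, ξ⟩, rfl⟩, rfl⟩
  exact ⟨g₀, ξ, ξ.2, rfl⟩

/-- Leg-2 version of `col₁_mem_span_embedded`. [cite: FultonHarrisGTM129, Thm. 6.3] -/
theorem col₂_mem_span_embedded (Φ₁ : Matrix α' (Word a m) ℂ) (Φ : Matrix (Fin N) (Fin b) ℂ)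
    (Φ₃ : Matrix γ' (Word c m) ℂ) (mu : Nat.Partition m) (A : Matrix (Word a m) (Word a m) ℂ)
    (C : Matrix (Word c m) (Word c m) ℂ) (Xs : Word a m → Word b m → Word c m → ℂ) (x : α') (z : γ') :
    (fun y' => actTensor Φ₁ (powMat Φ m) Φ₃ (actTensor A (wordIsotypicMatrix b m mu) C Xs) x y' z) ∈
      Submodule.span ℂ {v : Word N m → ℂ | ∃ (g₀ : GL (Fin b) ℂ) (ξ : Word b m → ℂ),
        ξ ∈ highestWeightSpace (wordRep ℂ b m) (Weight.ofPartition b mu) ∧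
        v = powMat Φ m *ᵥ wordRep ℂ b m g₀ ξ} := by
  rw [col₂_actTensor]
  have hGsum : (fun y' => ∑ x', ∑ z', Φ₁ x x' * Φ₃ z z' * actTensor A (wordIsotypicMatrix b m mu) C Xs x' y' z') =
      ∑ x', ∑ z', (Φ₁ x x' * Φ₃ z z') • fun y' => actTensor A (wordIsotypicMatrix b m mu) C Xs x' y' z' := by
    funext y'; simp only [Finset.sum_apply, Pi.smul_apply, smul_eq_mul]
  have hGmem : (fun y' => ∑ x', ∑ z', Φ₁ x x' * Φ₃ z z' * actTensor A (wordIsotypicMatrix b m mu) C Xs x' y' z') ∈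
      Submodule.span ℂ (Set.range fun p : GL (Fin b) ℂ ×
        highestWeightSpace (wordRep ℂ b m) (Weight.ofPartition b mu) => wordRep ℂ b m p.1 (p.2 : Word b m → ℂ)) := by
    rw [← range_isotypicProj_wordPermRep, hGsum]
    refine Submodule.sum_mem _ fun x' _ => Submodule.sum_mem _ fun z' _ => Submodule.smul_mem _ _ ?_
    rw [col₂_actTensor, wordIsotypicMatrix_mulVec]
    exact ⟨_, rfl⟩
  have hmap := Submodule.mem_map_of_mem (f := Matrix.mulVecLin (powMat Φ m)) hGmem
  rw [Submodule.map_span] at hmap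
  refine Submodule.span_mono ?_ hmap
  rintro _ ⟨_, ⟨⟨g₀, ξ⟩, rfl⟩, rfl⟩
  exact ⟨g₀, ξ, ξ.2, rfl⟩

/-- Leg-3 version of `col₁_mem_span_embedded`. [cite: FultonHarrisGTM129, Thm. 6.3] -/
theorem col₃_mem_span_embedded (Φ₁ : Matrix α' (Word a m) ℂ) (Φ₂ : Matrix β' (Word b m) ℂ)
    (Φ : Matrix (Fin N) (Fin c) ℂ) (mu : Nat.Partition m) (A : Matrix (Word a m) (Word a m) ℂ)
    (B : Matrix (Word b m) (Word b m) ℂ) (Xs : Word a m → Word b m → Word c m → ℂ) (x : α') (y : β') :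
    (fun z' => actTensor Φ₁ Φ₂ (powMat Φ m) (actTensor A B (wordIsotypicMatrix c m mu) Xs) x y z') ∈
      Submodule.span ℂ {v : Word N m → ℂ | ∃ (g₀ : GL (Fin c) ℂ) (ξ : Word c m → ℂ),
        ξ ∈ highestWeightSpace (wordRep ℂ c m) (Weight.ofPartition c mu) ∧
        v = powMat Φ m *ᵥ wordRep ℂ c m g₀ ξ} := by
  rw [col₃_actTensor]
  have hGsum : (fun z' => ∑ x', ∑ y', Φ₁ x x' * Φ₂ y y' * actTensor A B (wordIsotypicMatrix c m mu) Xs x' y' z') =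
      ∑ x', ∑ y', (Φ₁ x x' * Φ₂ y y') • fun z' => actTensor A B (wordIsotypicMatrix c m mu) Xs x' y' z' := by
    funext z'; simp only [Finset.sum_apply, Pi.smul_apply, smul_eq_mul]
  have hGmem : (fun z' => ∑ x', ∑ y', Φ₁ x x' * Φ₂ y y' * actTensor A B (wordIsotypicMatrix c m mu) Xs x' y' z') ∈
      Submodule.span ℂ (Set.range fun p : GL (Fin c) ℂ ×
        highestWeightSpace (wordRep ℂ c m) (Weight.ofPartition c mu) => wordRep ℂ c m p.1 (p.2 : Word c m → ℂ)) := by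
    rw [← range_isotypicProj_wordPermRep, hGsum]
    refine Submodule.sum_mem _ fun x' _ => Submodule.sum_mem _ fun y' _ => Submodule.smul_mem _ _ ?_
    rw [col₃_actTensor, wordIsotypicMatrix_mulVec]
    exact ⟨_, rfl⟩
  have hmap := Submodule.mem_map_of_mem (f := Matrix.mulVecLin (powMat Φ m)) hGmem
  rw [Submodule.map_span] at hmap
  refine Submodule.span_mono ?_ hmap
  rintro _ ⟨_, ⟨⟨g₀, ξ⟩, rfl⟩, rfl⟩
  exact ⟨g₀, ξ, ξ.2, rfl⟩

end LegColumns

section LegExtraction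

variable {α β γ : Type*} [Fintype α] [Fintype β] [Fintype γ] [DecidableEq α] [DecidableEq β]
  [DecidableEq γ]

/-- If `(P ⊗ B ⊗ C)·T ≠ 0` then `P` does not kill some leg-1 column of `T`. [folklore] -/
theorem exists_col₁_mulVec_ne_zero {P : Matrix α α ℂ} {B : Matrix β β ℂ} {C : Matrix γ γ ℂ}
    {T : α → β → γ → ℂ} (h : actTensor P B C T ≠ 0) : ∃ y z, P *ᵥ (fun x => T x y z) ≠ 0 := by
  have h1 : actTensor P (1 : Matrix β β ℂ) (1 : Matrix γ γ ℂ) T ≠ 0 := by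
    intro h0
    apply h
    have : actTensor P B C T = actTensor (1 : Matrix α α ℂ) B C (actTensor P 1 1 T) := by
      rw [actTensor_actTensor, Matrix.one_mul, Matrix.mul_one, Matrix.mul_one]
    rw [this, h0, actTensor_zero]
  obtain ⟨x, hx⟩ := Function.ne_iff.1 h1
  obtain ⟨y, hy⟩ := Function.ne_iff.1 hx
  obtain ⟨z, hz⟩ := Function.ne_iff.1 hy
  refine ⟨y, z, Function.ne_iff.2 ⟨x, ?_⟩⟩
  rw [actTensor_leg₁_apply] at hz
  simpa using hz

/-- If `(A ⊗ P ⊗ C)·T ≠ 0` then `P` does not kill some leg-2 column of `T`. [folklore] -/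
theorem exists_col₂_mulVec_ne_zero {A : Matrix α α ℂ} {P : Matrix β β ℂ} {C : Matrix γ γ ℂ}
    {T : α → β → γ → ℂ} (h : actTensor A P C T ≠ 0) : ∃ x z, P *ᵥ (fun y => T x y z) ≠ 0 := by
  have h1 : actTensor (1 : Matrix α α ℂ) P (1 : Matrix γ γ ℂ) T ≠ 0 := by
    intro h0
    apply h
    have : actTensor A P C T = actTensor A (1 : Matrix β β ℂ) C (actTensor 1 P 1 T) := by
      rw [actTensor_actTensor, Matrix.one_mul, Matrix.mul_one, Matrix.mul_one]
    rw [this, h0, actTensor_zero]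
  obtain ⟨x, hx⟩ := Function.ne_iff.1 h1
  obtain ⟨y, hy⟩ := Function.ne_iff.1 hx
  obtain ⟨z, hz⟩ := Function.ne_iff.1 hy
  refine ⟨x, z, Function.ne_iff.2 ⟨y, ?_⟩⟩
  rw [actTensor_leg₂_apply] at hz
  simpa using hz

/-- If `(A ⊗ B ⊗ P)·T ≠ 0` then `P` does not kill some leg-3 column of `T`. [folklore] -/
theorem exists_col₃_mulVec_ne_zero {A : Matrix α α ℂ} {B : Matrix β β ℂ} {P : Matrix γ γ ℂ}
    {T : α → β → γ → ℂ} (h : actTensor A B P T ≠ 0) : ∃ x y, P *ᵥ (fun z => T x y z) ≠ 0 := by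
  have h1 : actTensor (1 : Matrix α α ℂ) (1 : Matrix β β ℂ) P T ≠ 0 := by
    intro h0
    apply h
    have : actTensor A B P T = actTensor A B (1 : Matrix γ γ ℂ) (actTensor 1 1 P T) := by
      rw [actTensor_actTensor, Matrix.mul_one, Matrix.mul_one, Matrix.one_mul]
    rw [this, h0, actTensor_zero]
  obtain ⟨x, hx⟩ := Function.ne_iff.1 h1
  obtain ⟨y, hy⟩ := Function.ne_iff.1 hx
  obtain ⟨z, hz⟩ := Function.ne_iff.1 hy
  refine ⟨x, y, Function.ne_iff.2 ⟨z, ?_⟩⟩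
  rw [actTensor_leg₃_apply] at hz
  simpa using hz

end LegExtraction

/-! ## §10 The bound for a full admissible triple of `s'' + t''` -/

section Main

variable {a b c a' b' c' : ℕ}

/-- `0^{⊗m} = 0` for `m ≥ 1`. [folklore] -/
theorem kroneckerPow_zero_of_pos {ι κ μ : Type*} {m : ℕ} (hm : 0 < m) :
    kroneckerPow (0 : ι → κ → μ → ℂ) m = 0 := by
  funext u v w
  rw [kroneckerPow_apply]
  exact Finset.prod_eq_zero (Finset.mem_univ ⟨0, hm⟩) rfl

/-- The isotypic decomposition of a 3-leg tensor on words as a single sum over triples of shapes.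
[cite: ChristandlVranaZuiddam2023, §3.1 (sw)] -/
theorem eq_sum_actTensor_wordIsotypicMatrix₃ {m : ℕ} (Y : Word a m → Word b m → Word c m → ℂ) :
    Y = ∑ mu : Nat.Partition m × Nat.Partition m × Nat.Partition m,
      actTensor (wordIsotypicMatrix a m mu.1) (wordIsotypicMatrix b m mu.2.1) (wordIsotypicMatrix c m mu.2.2) Y := by
  calc Y = ∑ mu₁ : Nat.Partition m, ∑ mu₂ : Nat.Partition m, ∑ mu₃ : Nat.Partition m,
      actTensor (wordIsotypicMatrix a m mu₁) (wordIsotypicMatrix b m mu₂) (wordIsotypicMatrix c m mu₃) Y :=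
        eq_sum_actTensor_wordIsotypicMatrix Y
    _ = ∑ mu₁ : Nat.Partition m, ∑ p : Nat.Partition m × Nat.Partition m,
      actTensor (wordIsotypicMatrix a m mu₁) (wordIsotypicMatrix b m p.1) (wordIsotypicMatrix c m p.2) Y :=
        Finset.sum_congr rfl fun mu₁ _ => (Fintype.sum_prod_type' (f := fun mu₂ mu₃ =>
          actTensor (wordIsotypicMatrix a m mu₁) (wordIsotypicMatrix b m mu₂) (wordIsotypicMatrix c m mu₃) Y)).symm
    _ = _ := (Fintype.sum_prod_type' (f := fun (mu₁ : Nat.Partition m) (p : Nat.Partition m × Nat.Partition m) =>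
          actTensor (wordIsotypicMatrix a m mu₁) (wordIsotypicMatrix b m p.1) (wordIsotypicMatrix c m p.2) Y)).symm

/-- **The bound for a full admissible triple of the concatenated tensor** (CVZ, proof of Lemma 3.11
with Lemma 3.10.2 in dominance form and Lemma 3.12): let `s, t` be 3-tensors on alphabets
`Fin a, …` and `Fin a', …`, embedded into the concatenated alphabets by `Φ_V = (δ_{x, castAdd i})`,
`Φ_W = (δ_{x, natAdd j})`. If `(P_{λ₁} ⊗ P_{λ₂} ⊗ P_{λ₃}) (Φ_V·s + Φ_W·t)^{⊗n} ≠ 0` (`n ≥ 1`), then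
for every `θ ∈ P([3])`, `∑ θⱼ H(λ̄ⱼ) ≤ log₂(F^θ(s) + F^θ(t))`.
[cite: ChristandlVranaZuiddam2023, Lemma 3.11] -/
theorem weightedEntropy_le_logb_of_full_triple {θ : Fin 3 → ℝ} (hθ : θ ∈ stdSimplex ℝ (Fin 3))
    (s : Fin a → Fin b → Fin c → ℂ) (t : Fin a' → Fin b' → Fin c' → ℂ) {n : ℕ} (hn : 0 < n)
    {lam₁ lam₂ lam₃ : Nat.Partition n}
    (h : actTensor (wordIsotypicMatrix (a + a') n lam₁) (wordIsotypicMatrix (b + b') n lam₂)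
      (wordIsotypicMatrix (c + c') n lam₃)
      (kroneckerPow
        (actTensor ((1 : Matrix (Fin (a + a')) (Fin (a + a')) ℂ).submatrix id (Fin.castAdd a'))
            ((1 : Matrix (Fin (b + b')) (Fin (b + b')) ℂ).submatrix id (Fin.castAdd b'))
            ((1 : Matrix (Fin (c + c')) (Fin (c + c')) ℂ).submatrix id (Fin.castAdd c')) s +
          actTensor ((1 : Matrix (Fin (a + a')) (Fin (a + a')) ℂ).submatrix id (Fin.natAdd a))
            ((1 : Matrix (Fin (b + b')) (Fin (b + b')) ℂ).submatrix id (Fin.natAdd b))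
            ((1 : Matrix (Fin (c + c')) (Fin (c + c')) ℂ).submatrix id (Fin.natAdd c)) t) n) ≠ 0) :
    θ 0 * partitionEntropy lam₁ + θ 1 * partitionEntropy lam₂ + θ 2 * partitionEntropy lam₃ ≤
      Real.logb 2 (upperQuantumFunctional θ s + upperQuantumFunctional θ t) := by
  classical
  have hθ0 := hθ.1 0
  have hθ1 := hθ.1 1
  have hθ2 := hθ.1 2
  have hsum : θ 0 + θ 1 + θ 2 = 1 := by
    have h1 := hθ.2
    rw [Fin.sum_univ_three] at h1
    exact h1
  -- binomial expansion, a nonzero term, a splitting adapted to it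
  rw [kroneckerPow_add_eq_sum, actTensor_tensor_sum] at h
  obtain ⟨S, -, hS⟩ := Finset.exists_ne_zero_of_sum_ne_zero h
  obtain ⟨m, k, e, hl, hr⟩ := exists_splitting S
  rw [binomialTerm_eq_conc _ _ hl hr, kroneckerPow_actTensor_powMat, kroneckerPow_actTensor_powMat] at hS
  have hmk : m + k = n := by simpa using Fintype.card_congr e
  have hnR : (0 : ℝ) < n := by exact_mod_cast hn
  -- isotypic decompositions of the two small powers, bilinearity, a nonzero pair of triples
  rw [eq_sum_actTensor_wordIsotypicMatrix₃ (kroneckerPow s m), eq_sum_actTensor_wordIsotypicMatrix₃ (kroneckerPow t k),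
    actTensor_tensor_sum, actTensor_tensor_sum, conc_sum_left, actTensor_tensor_sum] at hS
  obtain ⟨mu, -, hmu⟩ := Finset.exists_ne_zero_of_sum_ne_zero hS
  rw [conc_sum_right, actTensor_tensor_sum] at hmu
  obtain ⟨nu, -, hT⟩ := Finset.exists_ne_zero_of_sum_ne_zero hmu
  -- the small projected powers do not vanish
  have hX₀ : actTensor (wordIsotypicMatrix a m mu.1) (wordIsotypicMatrix b m mu.2.1) (wordIsotypicMatrix c m mu.2.2)
      (kroneckerPow s m) ≠ 0 := by
    intro h0
    apply hT
    have hz : (fun (u : Word (a + a') n) (v : Word (b + b') n) (w : Word (c + c') n) =>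
        actTensor (powMat ((1 : Matrix (Fin (a + a')) (Fin (a + a')) ℂ).submatrix id (Fin.castAdd a')) m)
          (powMat ((1 : Matrix (Fin (b + b')) (Fin (b + b')) ℂ).submatrix id (Fin.castAdd b')) m)
          (powMat ((1 : Matrix (Fin (c + c')) (Fin (c + c')) ℂ).submatrix id (Fin.castAdd c')) m)
          (actTensor (wordIsotypicMatrix a m mu.1) (wordIsotypicMatrix b m mu.2.1) (wordIsotypicMatrix c m mu.2.2)
            (kroneckerPow s m)) (u ∘ ⇑e ∘ Sum.inl) (v ∘ ⇑e ∘ Sum.inl) (w ∘ ⇑e ∘ Sum.inl) *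
        actTensor (powMat ((1 : Matrix (Fin (a + a')) (Fin (a + a')) ℂ).submatrix id (Fin.natAdd a)) k)
          (powMat ((1 : Matrix (Fin (b + b')) (Fin (b + b')) ℂ).submatrix id (Fin.natAdd b)) k)
          (powMat ((1 : Matrix (Fin (c + c')) (Fin (c + c')) ℂ).submatrix id (Fin.natAdd c)) k)
          (actTensor (wordIsotypicMatrix a' k nu.1) (wordIsotypicMatrix b' k nu.2.1) (wordIsotypicMatrix c' k nu.2.2)
            (kroneckerPow t k)) (u ∘ ⇑e ∘ Sum.inr) (v ∘ ⇑e ∘ Sum.inr) (w ∘ ⇑e ∘ Sum.inr)) = 0 := by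
      funext u v w
      simp [h0]
    rw [hz, actTensor_zero]
  have hY₀ : actTensor (wordIsotypicMatrix a' k nu.1) (wordIsotypicMatrix b' k nu.2.1) (wordIsotypicMatrix c' k nu.2.2)
      (kroneckerPow t k) ≠ 0 := by
    intro h0
    apply hT
    have hz : (fun (u : Word (a + a') n) (v : Word (b + b') n) (w : Word (c + c') n) =>
        actTensor (powMat ((1 : Matrix (Fin (a + a')) (Fin (a + a')) ℂ).submatrix id (Fin.castAdd a')) m)
          (powMat ((1 : Matrix (Fin (b + b')) (Fin (b + b')) ℂ).submatrix id (Fin.castAdd b')) m)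
          (powMat ((1 : Matrix (Fin (c + c')) (Fin (c + c')) ℂ).submatrix id (Fin.castAdd c')) m)
          (actTensor (wordIsotypicMatrix a m mu.1) (wordIsotypicMatrix b m mu.2.1) (wordIsotypicMatrix c m mu.2.2)
            (kroneckerPow s m)) (u ∘ ⇑e ∘ Sum.inl) (v ∘ ⇑e ∘ Sum.inl) (w ∘ ⇑e ∘ Sum.inl) *
        actTensor (powMat ((1 : Matrix (Fin (a + a')) (Fin (a + a')) ℂ).submatrix id (Fin.natAdd a)) k)
          (powMat ((1 : Matrix (Fin (b + b')) (Fin (b + b')) ℂ).submatrix id (Fin.natAdd b)) k)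
          (powMat ((1 : Matrix (Fin (c + c')) (Fin (c + c')) ℂ).submatrix id (Fin.natAdd c)) k)
          (actTensor (wordIsotypicMatrix a' k nu.1) (wordIsotypicMatrix b' k nu.2.1) (wordIsotypicMatrix c' k nu.2.2)
            (kroneckerPow t k)) (u ∘ ⇑e ∘ Sum.inr) (v ∘ ⇑e ∘ Sum.inr) (w ∘ ⇑e ∘ Sum.inr)) = 0 := by
      funext u v w
      simp [h0]
    rw [hz, actTensor_zero]
  have hs : 0 < m → s ≠ 0 := by
    intro hm hs0
    apply hX₀
    rw [hs0, kroneckerPow_zero_of_pos hm, actTensor_zero]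
  have ht : 0 < k → t ≠ 0 := by
    intro hk ht0
    apply hY₀
    rw [ht0, kroneckerPow_zero_of_pos hk, actTensor_zero]
  -- the three leg bounds (the heart)
  obtain ⟨y₁, z₁, hc₁⟩ := exists_col₁_mulVec_ne_zero hT
  have hb₁ := partitionEntropy_le_of_mulVec_conc_ne_zero e
    (col₁_mem_span_embedded _ _ _ mu.1 _ _ _ (y₁ ∘ ⇑e ∘ Sum.inl) (z₁ ∘ ⇑e ∘ Sum.inl))
    (col₁_mem_span_embedded _ _ _ nu.1 _ _ _ (y₁ ∘ ⇑e ∘ Sum.inr) (z₁ ∘ ⇑e ∘ Sum.inr)) hc₁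
  obtain ⟨x₂, z₂, hc₂⟩ := exists_col₂_mulVec_ne_zero hT
  have hb₂ := partitionEntropy_le_of_mulVec_conc_ne_zero e
    (col₂_mem_span_embedded _ _ _ mu.2.1 _ _ _ (x₂ ∘ ⇑e ∘ Sum.inl) (z₂ ∘ ⇑e ∘ Sum.inl))
    (col₂_mem_span_embedded _ _ _ nu.2.1 _ _ _ (x₂ ∘ ⇑e ∘ Sum.inr) (z₂ ∘ ⇑e ∘ Sum.inr)) hc₂
  obtain ⟨x₃, y₃, hc₃⟩ := exists_col₃_mulVec_ne_zero hT
  have hb₃ := partitionEntropy_le_of_mulVec_conc_ne_zero e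
    (col₃_mem_span_embedded _ _ _ mu.2.2 _ _ _ (x₃ ∘ ⇑e ∘ Sum.inl) (y₃ ∘ ⇑e ∘ Sum.inl))
    (col₃_mem_span_embedded _ _ _ nu.2.2 _ _ _ (x₃ ∘ ⇑e ∘ Sum.inr) (y₃ ∘ ⇑e ∘ Sum.inr)) hc₃
  -- the admissible values for `s` and `t`
  set p : ℝ := (m : ℝ) / n with hp
  set q : ℝ := (k : ℝ) / n with hq
  have hp0 : 0 ≤ p := by positivity
  have hq0 : 0 ≤ q := by positivity
  have hpq : p + q = 1 := by
    rw [hp, hq, ← add_div, div_eq_one_iff_eq hnR.ne']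
    exact_mod_cast hmk
  set Es := upperLogQuantumFunctional θ s with hEs
  set Et := upperLogQuantumFunctional θ t with hEt
  have hEs0 : 0 ≤ Es := upperLogQuantumFunctional_nonneg hθ.1 s
  have hEt0 : 0 ≤ Et := upperLogQuantumFunctional_nonneg hθ.1 t
  have hμ : p * (θ 0 * partitionEntropy mu.1 + θ 1 * partitionEntropy mu.2.1 + θ 2 * partitionEntropy mu.2.2) ≤
      p * Es := by
    rcases Nat.eq_zero_or_pos m with hm | hm
    · simp [hp, hm]
    · refine mul_le_mul_of_nonneg_left ?_ hp0
      have hadm : UpperAdmissible θ s m ![mu.1, mu.2.1, mu.2.2] :=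
        upperAdmissible_of_actTensor_wordIsotypicMatrix_ne_zero θ hX₀
      exact weightedPartitionEntropy_le_upperLogQuantumFunctional schurWeyl_isotypicSum_eq_zero_holds hθ.1 hm hadm
  have hν : q * (θ 0 * partitionEntropy nu.1 + θ 1 * partitionEntropy nu.2.1 + θ 2 * partitionEntropy nu.2.2) ≤
      q * Et := by
    rcases Nat.eq_zero_or_pos k with hk | hk
    · simp [hq, hk]
    · refine mul_le_mul_of_nonneg_left ?_ hq0
      have hadm : UpperAdmissible θ t k ![nu.1, nu.2.1, nu.2.2] :=
        upperAdmissible_of_actTensor_wordIsotypicMatrix_ne_zero θ hY₀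
      exact weightedPartitionEntropy_le_upperLogQuantumFunctional schurWeyl_isotypicSum_eq_zero_holds hθ.1 hk hadm
  -- combine: `∑ θⱼ H(λⱼ) ≤ h(p) + p Es + q Et`
  have key : θ 0 * partitionEntropy lam₁ + θ 1 * partitionEntropy lam₂ + θ 2 * partitionEntropy lam₃ ≤
      (Real.negMulLog p + Real.negMulLog q) / Real.log 2 + p * Es + q * Et := by
    have e1 := mul_le_mul_of_nonneg_left hb₁ hθ0
    have e2 := mul_le_mul_of_nonneg_left hb₂ hθ1
    have e3 := mul_le_mul_of_nonneg_left hb₃ hθ2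
    have hl2 : 0 ≤ (Real.negMulLog p + Real.negMulLog q) / Real.log 2 := by
      have hq1 : q ≤ 1 := by linarith
      have hp1 : p ≤ 1 := by linarith
      exact div_nonneg (add_nonneg (Real.negMulLog_nonneg hp0 hp1) (Real.negMulLog_nonneg hq0 hq1))
        (Real.log_nonneg one_le_two)
    nlinarith
  -- the final comparison with `log₂(F^θ(s) + F^θ(t))`
  rcases Nat.eq_zero_or_pos m with hm | hm
  · -- `m = 0`: only `t` matters
    have hk : 0 < k := by omega
    have ht0 : t ≠ 0 := ht hk
    have hp' : p = 0 := by simp [hp, hm]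
    have hq' : q = 1 := by linarith
    rw [hp', hq', Real.negMulLog_zero, Real.negMulLog_one] at key
    simp only [zero_add, zero_div, zero_mul, one_mul, add_zero] at key
    refine key.trans ?_
    rw [upperQuantumFunctional_of_ne_zero θ ht0]
    exact le_logb_add_rpow (upperQuantumFunctional_nonneg θ s) _
  rcases Nat.eq_zero_or_pos k with hk | hk
  · -- `k = 0`: only `s` matters
    have hs0 : s ≠ 0 := hs hm
    have hq' : q = 0 := by simp [hq, hk]
    have hp' : p = 1 := by linarith
    rw [hp', hq', Real.negMulLog_zero, Real.negMulLog_one] at key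
    simp only [zero_add, zero_div, zero_mul, one_mul, add_zero] at key
    refine key.trans ?_
    rw [upperQuantumFunctional_of_ne_zero θ hs0, add_comm]
    exact le_logb_add_rpow (upperQuantumFunctional_nonneg θ t) _
  · -- both positive: Lemma 3.12
    have hs0 : s ≠ 0 := hs hm
    have ht0 : t ≠ 0 := ht hk
    rw [upperQuantumFunctional_of_ne_zero θ hs0, upperQuantumFunctional_of_ne_zero θ ht0]
    refine key.trans ?_
    have hq' : q = 1 - p := by linarith
    rw [hq']
    exact binEntropy_add_weights_le_logb Es Et hp0 (by linarith)

end Main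

/-! ## §11 Sub-additivity of `F^θ` under direct sum and the discharges -/

section Final

variable {a b c a' b' c' : ℕ}

/-- **`E^θ(Φ_V·s + Φ_W·t) ≤ log₂(F^θ(s) + F^θ(t))`** for 3-tensors on alphabets `Fin _`: every
admissible triple (Def. 3.3) is completed to a full one (`∑_ν P_ν = 1` on the legs with `θⱼ = 0`)
and bounded by `weightedEntropy_le_logb_of_full_triple`. [cite: ChristandlVranaZuiddam2023, Lemma 3.11] -/
theorem upperLogQuantumFunctional_embSum_le {θ : Fin 3 → ℝ} (hθ : θ ∈ stdSimplex ℝ (Fin 3))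
    (s : Fin a → Fin b → Fin c → ℂ) (t : Fin a' → Fin b' → Fin c' → ℂ) :
    upperLogQuantumFunctional θ
        (actTensor ((1 : Matrix (Fin (a + a')) (Fin (a + a')) ℂ).submatrix id (Fin.castAdd a'))
            ((1 : Matrix (Fin (b + b')) (Fin (b + b')) ℂ).submatrix id (Fin.castAdd b'))
            ((1 : Matrix (Fin (c + c')) (Fin (c + c')) ℂ).submatrix id (Fin.castAdd c')) s +
          actTensor ((1 : Matrix (Fin (a + a')) (Fin (a + a')) ℂ).submatrix id (Fin.natAdd a))
            ((1 : Matrix (Fin (b + b')) (Fin (b + b')) ℂ).submatrix id (Fin.natAdd b))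
            ((1 : Matrix (Fin (c + c')) (Fin (c + c')) ℂ).submatrix id (Fin.natAdd c)) t) ≤
      Real.logb 2 (upperQuantumFunctional θ s + upperQuantumFunctional θ t) := by
  classical
  refine Real.sSup_le ?_ ?_
  · rintro _ ⟨n, lam, hn, hadm, rfl⟩
    obtain ⟨z, hz, heq⟩ := upperProjection_eq_smul_actTensor θ lam (kroneckerPow
      (actTensor ((1 : Matrix (Fin (a + a')) (Fin (a + a')) ℂ).submatrix id (Fin.castAdd a'))
          ((1 : Matrix (Fin (b + b')) (Fin (b + b')) ℂ).submatrix id (Fin.castAdd b'))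
          ((1 : Matrix (Fin (c + c')) (Fin (c + c')) ℂ).submatrix id (Fin.castAdd c')) s +
        actTensor ((1 : Matrix (Fin (a + a')) (Fin (a + a')) ℂ).submatrix id (Fin.natAdd a))
          ((1 : Matrix (Fin (b + b')) (Fin (b + b')) ℂ).submatrix id (Fin.natAdd b))
          ((1 : Matrix (Fin (c + c')) (Fin (c + c')) ℂ).submatrix id (Fin.natAdd c)) t) n)
    obtain ⟨lam', hlam', hne⟩ := exists_full_triple θ lam (X := kroneckerPow
      (actTensor ((1 : Matrix (Fin (a + a')) (Fin (a + a')) ℂ).submatrix id (Fin.castAdd a'))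
          ((1 : Matrix (Fin (b + b')) (Fin (b + b')) ℂ).submatrix id (Fin.castAdd b'))
          ((1 : Matrix (Fin (c + c')) (Fin (c + c')) ℂ).submatrix id (Fin.castAdd c')) s +
        actTensor ((1 : Matrix (Fin (a + a')) (Fin (a + a')) ℂ).submatrix id (Fin.natAdd a))
          ((1 : Matrix (Fin (b + b')) (Fin (b + b')) ℂ).submatrix id (Fin.natAdd b))
          ((1 : Matrix (Fin (c + c')) (Fin (c + c')) ℂ).submatrix id (Fin.natAdd c)) t) n)
      (fun h0 => hadm (by rw [heq, h0, smul_zero]))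
    have key := weightedEntropy_le_logb_of_full_triple hθ s t hn hne
    have hw : weightedPartitionEntropy θ lam =
        θ 0 * partitionEntropy (lam' 0) + θ 1 * partitionEntropy (lam' 1) + θ 2 * partitionEntropy (lam' 2) := by
      unfold weightedPartitionEntropy
      have e : ∀ j, θ j * partitionEntropy (lam j) = θ j * partitionEntropy (lam' j) := by
        intro j
        by_cases hj : θ j = 0
        · rw [hj, zero_mul, zero_mul]
        · rw [hlam' j hj]
      rw [e 0, e 1, e 2]
    rw [hw]
    exact key
  · -- the bound is nonnegative
    by_cases hst : s = 0 ∧ t = 0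
    · rw [hst.1, hst.2, upperQuantumFunctional_zero, upperQuantumFunctional_zero, add_zero, Real.logb_zero]
    · refine Real.logb_nonneg one_lt_two ?_
      rcases not_and_or.1 hst with hs | ht
      · have h1 : (1 : ℝ) ≤ upperQuantumFunctional θ s := by
          rw [upperQuantumFunctional_of_ne_zero θ hs]
          calc (1 : ℝ) = (2 : ℝ) ^ (0 : ℝ) := (Real.rpow_zero 2).symm
            _ ≤ (2 : ℝ) ^ upperLogQuantumFunctional θ s :=
              Real.rpow_le_rpow_of_exponent_le one_le_two (upperLogQuantumFunctional_nonneg hθ.1 s)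
        linarith [upperQuantumFunctional_nonneg θ t]
      · have h1 : (1 : ℝ) ≤ upperQuantumFunctional θ t := by
          rw [upperQuantumFunctional_of_ne_zero θ ht]
          calc (1 : ℝ) = (2 : ℝ) ^ (0 : ℝ) := (Real.rpow_zero 2).symm
            _ ≤ (2 : ℝ) ^ upperLogQuantumFunctional θ t :=
              Real.rpow_le_rpow_of_exponent_le one_le_two (upperLogQuantumFunctional_nonneg hθ.1 t)
        linarith [upperQuantumFunctional_nonneg θ s]

universe u

variable {ι κ μ ι' κ' μ' : Type u} [Fintype ι] [Fintype κ] [Fintype μ] [Fintype ι'] [Fintype κ']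
  [Fintype μ'] [DecidableEq ι] [DecidableEq κ] [DecidableEq μ] [DecidableEq ι'] [DecidableEq κ']
  [DecidableEq μ']

omit [Fintype ι'] [Fintype κ'] [Fintype μ'] [DecidableEq ι'] [DecidableEq κ'] [DecidableEq μ'] in
/-- `F^θ` is invariant under relabelling the bases (through `F^θ = F_θ`, Thm. 3.30, and the
invariance of `E_θ`). [cite: ChristandlVranaZuiddam2023, Thm. 3.30] -/
theorem upperQuantumFunctional_actTensor_relabel {θ : Fin 3 → ℝ} (hθ : θ ∈ stdSimplex ℝ (Fin 3))
    (e₁ : ι ≃ Fin a) (e₂ : κ ≃ Fin b) (e₃ : μ ≃ Fin c) (s : ι → κ → μ → ℂ) :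
    upperQuantumFunctional θ (actTensor ((1 : Matrix ι ι ℂ).submatrix (⇑e₁.symm) id)
      ((1 : Matrix κ κ ℂ).submatrix (⇑e₂.symm) id) ((1 : Matrix μ μ ℂ).submatrix (⇑e₃.symm) id) s) =
      upperQuantumFunctional θ s := by
  rw [upperQuantumFunctional_eq_quantumFunctional ChristandlVranaZuiddam2023_upper_eq_lower_holds hθ,
    upperQuantumFunctional_eq_quantumFunctional ChristandlVranaZuiddam2023_upper_eq_lower_holds hθ]
  have hback : actTensor ((1 : Matrix ι ι ℂ).submatrix (⇑e₁.symm) id)ᴴ ((1 : Matrix κ κ ℂ).submatrix (⇑e₂.symm) id)ᴴ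
      ((1 : Matrix μ μ ℂ).submatrix (⇑e₃.symm) id)ᴴ (actTensor ((1 : Matrix ι ι ℂ).submatrix (⇑e₁.symm) id)
        ((1 : Matrix κ κ ℂ).submatrix (⇑e₂.symm) id) ((1 : Matrix μ μ ℂ).submatrix (⇑e₃.symm) id) s) = s := by
    rw [actTensor_actTensor, conjTranspose_relabel_mul_self, conjTranspose_relabel_mul_self,
      conjTranspose_relabel_mul_self, actTensor_one]
  by_cases hs : s = 0
  · subst hs
    rw [actTensor_zero, quantumFunctional_zero, quantumFunctional_zero]
  · have hs' : actTensor ((1 : Matrix ι ι ℂ).submatrix (⇑e₁.symm) id) ((1 : Matrix κ κ ℂ).submatrix (⇑e₂.symm) id)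
        ((1 : Matrix μ μ ℂ).submatrix (⇑e₃.symm) id) s ≠ 0 := by
      intro h0
      apply hs
      rw [← hback, h0, actTensor_zero]
    rw [quantumFunctional_of_ne_zero θ hs', quantumFunctional_of_ne_zero θ hs,
      logQuantumFunctional_actTensor_relabel hθ.1]

/-- **CVZ Lemma 3.11 (sub-additivity of the upper quantum functional), `k = 3`**:
`F^θ(s ⊕ t) ≤ F^θ(s) + F^θ(t)` for `θ ∈ P([3])` and complex 3-tensors on finite index types.
Relabel the summands onto alphabets `Fin _` and `s ⊕ t` onto the concatenated alphabets, where
`E·(s ⊕ t) = Φ_V·(e·s) + Φ_W·(e'·t)`; then `E^θ(s ⊕ t) = E^θ(Φ_V·s_F + Φ_W·t_F) ≤ log₂(F^θ(s) + F^θ(t))`.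
[cite: ChristandlVranaZuiddam2023, Lemma 3.11] -/
theorem upperQuantumFunctional_directSumTensor_le {θ : Fin 3 → ℝ} (hθ : θ ∈ stdSimplex ℝ (Fin 3))
    (s : ι → κ → μ → ℂ) (t : ι' → κ' → μ' → ℂ) :
    upperQuantumFunctional θ (directSumTensor s t) ≤ upperQuantumFunctional θ s + upperQuantumFunctional θ t := by
  classical
  by_cases hu : directSumTensor s t = 0
  · rw [hu, upperQuantumFunctional_zero]
    exact add_nonneg (upperQuantumFunctional_nonneg θ s) (upperQuantumFunctional_nonneg θ t)
  set eι := Fintype.equivFin ι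
  set eκ := Fintype.equivFin κ
  set eμ := Fintype.equivFin μ
  set eι' := Fintype.equivFin ι'
  set eκ' := Fintype.equivFin κ'
  set eμ' := Fintype.equivFin μ'
  -- `E^θ(s ⊕ t) = E^θ(Φ_V·s_F + Φ_W·t_F)`
  have hrel : upperLogQuantumFunctional θ (directSumTensor s t) = upperLogQuantumFunctional θ
      (actTensor ((1 : Matrix (Fin (Fintype.card ι + Fintype.card ι')) (Fin (Fintype.card ι + Fintype.card ι')) ℂ).submatrix
            id (Fin.castAdd (Fintype.card ι')))
          ((1 : Matrix (Fin (Fintype.card κ + Fintype.card κ')) (Fin (Fintype.card κ + Fintype.card κ')) ℂ).submatrix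
            id (Fin.castAdd (Fintype.card κ')))
          ((1 : Matrix (Fin (Fintype.card μ + Fintype.card μ')) (Fin (Fintype.card μ + Fintype.card μ')) ℂ).submatrix
            id (Fin.castAdd (Fintype.card μ')))
          (actTensor ((1 : Matrix ι ι ℂ).submatrix (⇑eι.symm) id) ((1 : Matrix κ κ ℂ).submatrix (⇑eκ.symm) id)
            ((1 : Matrix μ μ ℂ).submatrix (⇑eμ.symm) id) s) +
        actTensor ((1 : Matrix (Fin (Fintype.card ι + Fintype.card ι')) (Fin (Fintype.card ι + Fintype.card ι')) ℂ).submatrix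
            id (Fin.natAdd (Fintype.card ι)))
          ((1 : Matrix (Fin (Fintype.card κ + Fintype.card κ')) (Fin (Fintype.card κ + Fintype.card κ')) ℂ).submatrix
            id (Fin.natAdd (Fintype.card κ)))
          ((1 : Matrix (Fin (Fintype.card μ + Fintype.card μ')) (Fin (Fintype.card μ + Fintype.card μ')) ℂ).submatrix
            id (Fin.natAdd (Fintype.card μ)))
          (actTensor ((1 : Matrix ι' ι' ℂ).submatrix (⇑eι'.symm) id) ((1 : Matrix κ' κ' ℂ).submatrix (⇑eκ'.symm) id)
            ((1 : Matrix μ' μ' ℂ).submatrix (⇑eμ'.symm) id) t)) := by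
    rw [← actTensor_relabel_directSumTensor eι eκ eμ eι' eκ' eμ' s t,
      upperLogQuantumFunctional_eq_logQuantumFunctional hθ, upperLogQuantumFunctional_eq_logQuantumFunctional hθ,
      logQuantumFunctional_actTensor_relabel hθ.1]
  have hbound := upperLogQuantumFunctional_embSum_le hθ
    (actTensor ((1 : Matrix ι ι ℂ).submatrix (⇑eι.symm) id) ((1 : Matrix κ κ ℂ).submatrix (⇑eκ.symm) id)
      ((1 : Matrix μ μ ℂ).submatrix (⇑eμ.symm) id) s)
    (actTensor ((1 : Matrix ι' ι' ℂ).submatrix (⇑eι'.symm) id) ((1 : Matrix κ' κ' ℂ).submatrix (⇑eκ'.symm) id)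
      ((1 : Matrix μ' μ' ℂ).submatrix (⇑eμ'.symm) id) t)
  rw [upperQuantumFunctional_actTensor_relabel hθ, upperQuantumFunctional_actTensor_relabel hθ, ← hrel] at hbound
  -- exponentiate
  have hpos : 0 < upperQuantumFunctional θ s + upperQuantumFunctional θ t := by
    have hst : s ≠ 0 ∨ t ≠ 0 := by
      by_contra hno
      push Not at hno
      exact hu ((directSumTensor_eq_zero_iff s t).2 hno)
    rcases hst with hs | ht
    · have h1 : 0 < upperQuantumFunctional θ s := by
        rw [upperQuantumFunctional_of_ne_zero θ hs]; exact Real.rpow_pos_of_pos two_pos _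
      linarith [upperQuantumFunctional_nonneg θ t]
    · have h1 : 0 < upperQuantumFunctional θ t := by
        rw [upperQuantumFunctional_of_ne_zero θ ht]; exact Real.rpow_pos_of_pos two_pos _
      linarith [upperQuantumFunctional_nonneg θ s]
  rw [upperQuantumFunctional_of_ne_zero θ hu]
  calc (2 : ℝ) ^ upperLogQuantumFunctional θ (directSumTensor s t)
      ≤ (2 : ℝ) ^ Real.logb 2 (upperQuantumFunctional θ s + upperQuantumFunctional θ t) :=
        Real.rpow_le_rpow_of_exponent_le one_le_two hbound
    _ = upperQuantumFunctional θ s + upperQuantumFunctional θ t := Real.rpow_logb two_pos (by norm_num) hpos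

/-- **Discharge of `ChristandlVranaZuiddam2023_upper_subadditive` (CVZ Lemma 3.11).**
[cite: ChristandlVranaZuiddam2023, Lemma 3.11] -/
theorem ChristandlVranaZuiddam2023_upper_subadditive_holds : ChristandlVranaZuiddam2023_upper_subadditive.{u} :=
  fun _θ hθ _ι _κ _μ _ι' _κ' _μ' _ _ _ _ _ _ _ _ _ _ _ _ s t => upperQuantumFunctional_directSumTensor_le hθ s t

/-- **Discharge of `ChristandlVranaZuiddam2023_directSum_subadditive`**: `F_θ(s ⊕ t) ≤ F_θ(s) + F_θ(t)`
(Cor. 3.31, `≤` half: Lemma 3.11 with Thm. 3.30). [cite: ChristandlVranaZuiddam2023, Cor. 3.31] -/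
theorem ChristandlVranaZuiddam2023_directSum_subadditive_holds :
    ChristandlVranaZuiddam2023_directSum_subadditive.{u} :=
  ChristandlVranaZuiddam2023_directSum_subadditive_of_upper ChristandlVranaZuiddam2023_upper_subadditive_holds
    ChristandlVranaZuiddam2023_upper_eq_lower_holds

/-- **Discharge of `ChristandlVranaZuiddam2023_directSum` (CVZ Cor. 3.31, additivity of the quantum
functionals under direct sum)**: `F_θ(s ⊕ t) = F_θ(s) + F_θ(t)` for every `θ ∈ P([3])` and all complex
3-tensors on finite index types — super-additivity is Thm. 3.19.2
(`ChristandlVranaZuiddam2023_directSum_superadditive_holds`), sub-additivity is Lemma 3.11 with Thm. 3.30.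
[cite: ChristandlVranaZuiddam2023, Cor. 3.31] -/
theorem ChristandlVranaZuiddam2023_directSum_holds : ChristandlVranaZuiddam2023_directSum.{u} :=
  ChristandlVranaZuiddam2023_directSum_of_upper ChristandlVranaZuiddam2023_upper_subadditive_holds
    ChristandlVranaZuiddam2023_upper_eq_lower_holds

end Final


end Literature.Computability.AlgebraicComplexity

end
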